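import Literature.Barriers.AtomisticToContinuum.OneDimensionalHardCoreProofs
import Literature.Barriers.AtomisticToContinuum.OneDimensionalHardCoreNarrow
import Mathlib.Analysis.SpecialFunctions.Trigonometric.Chebyshev.Basic
import Mathlib.RingTheory.Polynomial.Chebyshev
import Mathlib.Topology.UniformSpace.Dini
import Mathlib.Analysis.Real.Pi.Bounds
import HarnessLib

/-!
# Impenetrable bosons between Dirichlet walls: no condensation into any mode

`Literature/Barriers/AtomisticToContinuum/` (D-0021 barrier catalogue), sub-problem
`BoseEinsteinCondensation`. Companion of `OneDimensionalHardCore.lean` (statement, BARRIER block),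
`OneDimensionalHardCoreProofs.lean` (ring: `c₀(N)/N → 0`) and `OneDimensionalHardCoreNarrow.lean`
(ring: uniform mode bound). Written by the tenth barrier audit of `OneDimensionalHardCoreProofs`
(refuter, 2026-08-16) as the typed support of evasion (iii) "boundary conditions" of the parent
entry, whose earlier Dirichlet companion (second audit) never reached the tree (parent caveats
(k)(3), (n)(5)). The conjunct `BoseEinsteinCondensation` is a DIRICHLET-box statement; the typed
one-dimensional witnesses so far were periodic (ring) ones.

**What is typed and proved.** `N` impenetrable (zero-range hard-core) bosons in the box `[0, L]`
with Dirichlet walls have the ground state `Ψ_N = |Φ_N|`, `Φ_N` the Slater determinant of the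
lowest `N` Dirichlet orbitals `√(2/L) sin(kπx/L)`, `k = 1, …, N` (Girardeau's map; "the absolute
value squared of the ground state wave function for `n` impenetrable bosons on the interval" is
the `Sp(n)`-type density `(1/n!)(1/2π)^n ∏ 4sin²θ_l ∏_{j<k} 4(cos θ_k − cos θ_j)²`
[ForresterFrankelGaroni2003, §1]). `OneDimensionalHardCoreDirichlet`: for every `L > 0` and
`ε > 0`, eventually in `N`, every mode `φ` with `|φ|²` integrable has
`|⟨φ, γ^D_N φ⟩| ≤ ε N ‖φ‖²` — the largest eigenvalue of the one-body density matrix is `o(N)`,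
uniformly over modes (`oneDimensionalHardCoreDirichlet_holds`, axioms `propext`,
`Classical.choice`, `Quot.sound`). Printed sharp law: `λ_j ∝ √N`, `λ₀ = G⁴(3/2)√N = 1.3069√N`
[ForresterFrankelGaroni2003, §4.1], derived there from the large-`N` form of the density matrix
obtained by Coulomb-gas arguments (§3); the pointwise bulk asymptotics of such Hankel/Jacobi
determinants with Fisher–Hartwig singularities are rigorous in [DeiftItsKrasovsky2011, Thm 1.20].
Non-vacuity: `ρ^D_N(a, a) = (2/L)∑_{k≤N} sin²(kπa/L)` and `∫₀ᴸ ρ^D_N(x, x) dx = N`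
(`dirichletDensity_self`, `integral_dirichletDensity_diag`); the conjunct's shape negated:
`not_exists_linear_le_dirichletForm`; scale invariance `⟨φ, γ^D_{N,L}φ⟩ = L⟨φ(L·), γ^D_{N,1}φ(L·)⟩`
(`dirichletForm_smul`) and the `L`-independent threshold (`oneDimensionalHardCoreDirichlet_uniform`),
so the bound holds along the thermodynamic limit `L_N = N/ρ`.

**Proof** (Schultz-type, as the ring proof; Parts A–H mirror `OneDimensionalHardCoreProofs`).
* Part A: `det[sin((t+1)θ_r)]_{r,t<N} = (∏_r sin θ_r)(∏_t 2^t) ∏_{r<s}(cos θ_s − cos θ_r)`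
  (`det_dSlater`; Chebyshev `sin((t+1)θ) = sin θ·U_t(cos θ)` and Mathlib's
  `det_eval_matrixOfPolynomials_eq_det_vandermonde`), hence Girardeau's sign identity
  `∏_j s(x_j) Φ(a, X)Φ(b, X) = |Φ(a, X)||Φ(b, X)|`, `s = 1 − 2·𝟙_{(a,b)}`, by monotonicity of
  `cos` on `[0, π]` (`sgn_det_det_eq_abs`).
* Parts C–E: Laplace expansion along the inserted point and Andréief (`integral_det_mul_det` of the
  ring file) give Lenard's formula `ρ^D_N(a, b) = (2/L)⟨f(b), adj(1 − 2Q) f(a)⟩`,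
  `f_t = sin((t+1)π·/L)`, `Q_{kl} = (2/L)∫_{(a,b)} f_k f_l` (`dirichletDensity_eq_adjugate`), using
  the orthogonality `∫₀ᴸ f_k f_l = (L/2)δ_{kl}` (`integral_dOrb_mul_dOrb`).
* Part F: the Hermitian adjugate bound of the ring file, applied to the complexified real
  symmetric matrix: `ρ^D_N(a, b) ≤ (2N/L) e^{1/2} e^{−2V_N(a,b)}`, `V_N = tr Q − ‖Q‖²_F` the
  free-fermion number variance of the arc (`dirichletDensity_le_exp_numVar`).
* Part G: Bessel's inequality for the sine system (`sum_sq_qD_le`) bounds `V_N` below by the block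
  `∑_{i,j<K} Q²_{N−1−i,N+j}`, `K = 4⌊N/4⌋`; in closed form `Q_{N−1−i,N+j} = c(i+j+1) − c(2N+1+j−i)`,
  `c(m) = (sin mβ − sin mα)/(mπ)`, `α = π min(a,b)/L`, `β = π max(a,b)/L`; the four-block lemma
  `∑_{j<4} w²_{y+j} ≥ (cos β − cos α)²(sin²α + sin²β)/15` for `w_y = sin yβ − sin yα` (the
  combination `w_{y+2} − 2cos α·w_{y+1} + w_y = 2(cos β − cos α) sin((y+1)β)` kills the `α`-wave,
  and two consecutive sines cannot both vanish, `sin_sq_le_two_mul`) and a triangular re-summation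
  give `V_N ≥ κ(a,b) H_{⌊N/4⌋}/(120π²) − 4/π²`, `κ = (cos θ_a − cos θ_b)²(sin²θ_a + sin²θ_b)`,
  `H` the harmonic number (`dNumVar_ge`).
* Part H: `ρ^D_N ≤ (2N/L)e^{3/2} g_N`, `g_N = exp(−κ H_{⌊N/4⌋}/(60π²)) ≤ 1`; `κ(x, ·)` vanishes only
  on a countable set, so the rows `∫₀ᴸ g_N(x, y)dy` tend to `0` for every `x` (dominated
  convergence), are continuous in `x` and non-increasing in `N`, hence tend to `0` UNIFORMLY on
  `[0, L]` by Dini's theorem (`Antitone.tendstoUniformlyOn_of_forall_tendsto`); the weighted AM–GM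
  argument of the Narrow file then gives the mode bound (`norm_dirichletForm_le`,
  `eventually_norm_dirichletForm_le`). Unlike the ring, the rows are not constant (no translation
  invariance), which is why Dini replaces the explicit row integral.

## References

* [ForresterFrankelGaroni2003] P. J. Forrester, N. E. Frankel, T. M. Garoni, *Random matrix
  averages and the impenetrable Bose gas in Dirichlet and Neumann boundary conditions*, J. Math.
  Phys. 44 (2003) 4157–4175, arXiv:math-ph/0301042: §1 (the Dirichlet/Neumann densities as
  `|ground state|²` of impenetrable bosons), §3 (the density matrices), §4.1 (`λ_j ∝ √N`,
  `λ₀ = G⁴(3/2)√N = 1.3069√N`).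
* [DeiftItsKrasovsky2011] P. Deift, A. Its, I. Krasovsky, *Asymptotics of Toeplitz, Hankel, and
  Toeplitz+Hankel determinants with Fisher–Hartwig singularities*, Ann. of Math. 174 (2011)
  1243–1299, arXiv:0905.0443: Thm 1.20.
* [ForresterEtAl2003] P. J. Forrester, N. E. Frankel, T. M. Garoni, N. S. Witte, Phys. Rev. A 67
  (2003) 043607, arXiv:cond-mat/0211126: §2.1.1–2.1.2 (Girardeau state, Heine/Andréief identity on
  the ring — the template of Parts A–E).
-/

noncomputable section

open MeasureTheory Filter Topology Finset Matrix Equiv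
open scoped BigOperators Real ComplexConjugate

namespace Literature.Barriers.AtomisticToContinuum.BoseGas

/-! ### Part A: the Dirichlet orbitals, the box ground state, and the product formula -/

section Orbitals

variable {n : ℕ} {L a b : ℝ}

/-- The (unnormalised) Dirichlet orbital `f_t(x) = sin((t+1)πx/L)` of the box `[0, L]`
(the normalised orbitals are `√(2/L) f_t`, `t = 0, 1, …`). [cite: ForresterFrankelGaroni2003, §1] -/
def dOrb (L : ℝ) (t : ℕ) (x : ℝ) : ℝ := Real.sin ((t + 1) * π * x / L)

/-- The free-fermion Slater matrix `M(x)_{r,t} = f_t(x_r)` of the lowest `N` Dirichlet orbitals.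
[cite: ForresterFrankelGaroni2003, §1] -/
def dSlater (N : ℕ) (L : ℝ) (x : Fin N → ℝ) : Matrix (Fin N) (Fin N) ℝ :=
  of fun r t => dOrb L t (x r)

/-- **The ground state of `N` impenetrable bosons in the box `[0, L]` with Dirichlet walls**
(Girardeau's Bose–Fermi map): the modulus of the free-fermion Slater determinant of the lowest
`N` Dirichlet orbitals, `Ψ_N(x) = (N! (L/2)^N)^{-1/2} |det[sin((t+1)πx_r/L)]_{r,t<N}|`, normalised on
`[0, L]^N`; equivalently `|Ψ_N|² = (1/N!)(1/2π)^N ∏_l 4sin²θ_l ∏_{j<k} 4(cos θ_k - cos θ_j)²` in the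
angles `θ = πx/L` (`det_dSlater`). [cite: ForresterFrankelGaroni2003, §1 (the Dirichlet p.d.f.)] -/
def dirichletState (N : ℕ) (L : ℝ) (x : Fin N → ℝ) : ℝ :=
  (Real.sqrt (N.factorial * (L / 2) ^ N))⁻¹ * |det (dSlater N L x)|

/-- The **one-body density matrix** of the Dirichlet box state,
`ρ^D_N(x, y) = N ∫_{[0,L]^{N-1}} Ψ_N(x, X) Ψ_N(y, X) dX` (`0` for `N = 0`).
[cite: ForresterFrankelGaroni2003, §3 (density matrix, Dirichlet case)] -/
def dirichletDensityMatrix : (N : ℕ) → ℝ → ℝ → ℝ → ℝ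
  | 0, _, _, _ => 0
  | n + 1, L, x, y => (n + 1 : ℝ) *
      ∫ X in Set.pi Set.univ (fun _ : Fin n => Set.Icc (0 : ℝ) L),
        dirichletState (n + 1) L (Fin.cons x X) * dirichletState (n + 1) L (Fin.cons y X)

/-- The Dirichlet orbitals are continuous. [folklore] -/
theorem continuous_dOrb (L : ℝ) (t : ℕ) : Continuous (dOrb L t) := by
  unfold dOrb; fun_prop

/-- `|f_t| ≤ 1`. [folklore] -/
theorem abs_dOrb_le_one (L : ℝ) (t : ℕ) (x : ℝ) : |dOrb L t x| ≤ 1 := Real.abs_sin_le_one _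

/-- The monic rescaling `2^{-t} U_t` of the Chebyshev polynomial of the second kind. [folklore] -/
def monicU (t : ℕ) : Polynomial ℝ :=
  Polynomial.C ((2 : ℝ) ^ t)⁻¹ * Polynomial.Chebyshev.U ℝ t

/-- `2^{-t} U_t` is monic. [folklore] -/
theorem monicU_monic (t : ℕ) : (monicU t).Monic := by
  unfold monicU
  apply Polynomial.monic_C_mul_of_mul_leadingCoeff_eq_one
  rw [Polynomial.Chebyshev.leadingCoeff_U_natCast]
  exact inv_mul_cancel₀ (pow_ne_zero _ two_ne_zero)

/-- `2^{-t} U_t` has degree `t`. [folklore] -/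
theorem monicU_natDegree (t : ℕ) : (monicU t).natDegree = t := by
  unfold monicU
  rw [Polynomial.natDegree_C_mul (inv_ne_zero (pow_ne_zero _ two_ne_zero)),
    Polynomial.Chebyshev.natDegree_U_natCast]

/-- `sin((t+1)θ) = sin θ · 2^t · (2^{-t}U_t)(cos θ)`. [folklore] -/
theorem dOrb_eq_monicU (L : ℝ) (t : ℕ) (x : ℝ) :
    dOrb L t x =
      Real.sin (π * x / L) * ((2 : ℝ) ^ t * (monicU t).eval (Real.cos (π * x / L))) := by
  unfold dOrb monicU
  rw [Polynomial.eval_mul, Polynomial.eval_C, ← mul_assoc ((2 : ℝ) ^ t),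
    mul_inv_cancel₀ (pow_ne_zero _ two_ne_zero), one_mul]
  have h := Polynomial.Chebyshev.U_real_cos (π * x / L) t
  push_cast at h
  rw [show ((t : ℝ) + 1) * π * x / L = ((t : ℝ) + 1) * (π * x / L) by ring, ← h]
  ring

/-- **Product formula for the Dirichlet Slater determinant**:
`det[sin((t+1)θ_r)] = (∏_r sin θ_r)(∏_t 2^t) ∏_{r<s}(cos θ_s - cos θ_r)`, `θ = πx/L`.
[cite: ForresterFrankelGaroni2003, §1 (the Dirichlet p.d.f.)] -/
theorem det_dSlater (N : ℕ) (L : ℝ) (x : Fin N → ℝ) :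
    det (dSlater N L x) =
      (∏ r, Real.sin (π * x r / L)) * ((∏ t : Fin N, (2 : ℝ) ^ (t : ℕ)) *
        det (vandermonde fun r => Real.cos (π * x r / L))) := by
  have h1 : dSlater N L x = of fun r t => Real.sin (π * x r / L) *
      ((of fun r (t : Fin N) => (2 : ℝ) ^ (t : ℕ) *
        (monicU t).eval (Real.cos (π * x r / L))) r t) := by
    ext r t
    simp only [dSlater, of_apply, dOrb_eq_monicU]
  have h2 : (of fun r (t : Fin N) => (2 : ℝ) ^ (t : ℕ) * (monicU t).eval (Real.cos (π * x r / L)) :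
      Matrix (Fin N) (Fin N) ℝ) =
      of fun r t => (fun t : Fin N => (2 : ℝ) ^ (t : ℕ)) t *
        (of fun r (t : Fin N) => (monicU t).eval (Real.cos (π * x r / L))) r t := by
    ext r t
    simp only [of_apply]
  rw [h1, det_mul_column, h2, det_mul_row,
    ← det_eval_matrixOfPolynomials_eq_det_vandermonde _ (fun t : Fin N => monicU t)
      (fun t => monicU_natDegree t) (fun t => monicU_monic t)]

/-- `cos(πt/L)` is non-increasing on `[0, L]`. [folklore] -/
theorem cos_div_antitone (hL : 0 < L) {u v : ℝ} (hu : 0 ≤ u) (huv : u ≤ v) (hv : v ≤ L) :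
    Real.cos (π * v / L) ≤ Real.cos (π * u / L) := by
  apply Real.cos_le_cos_of_nonneg_of_le_pi
  · exact div_nonneg (mul_nonneg Real.pi_pos.le hu) hL.le
  · rw [div_le_iff₀ hL]; nlinarith [Real.pi_pos]
  · exact div_le_div_of_nonneg_right (by nlinarith [Real.pi_pos]) hL.le

/-- Sign lemma for the Dirichlet orbitals: for `a, b, x ∈ [0, L]`,
`s(x)(cos θ_x − cos θ_a)(cos θ_x − cos θ_b) ≥ 0` with `s = 1 − 2·𝟙_{(min a b, max a b)}`
(cosine is monotone on `[0, π]`). [folklore] -/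
theorem sgnFun_mul_cos_sub_nonneg (hL : 0 < L)
    (ha : a ∈ Set.Icc 0 L) (hb : b ∈ Set.Icc 0 L) {x : ℝ} (hx : x ∈ Set.Icc 0 L) :
    0 ≤ sgnFun a b x * ((Real.cos (π * x / L) - Real.cos (π * a / L)) *
      (Real.cos (π * x / L) - Real.cos (π * b / L))) := by
  wlog hab : a ≤ b generalizing a b
  · rw [sgnFun_comm, mul_comm (Real.cos _ - _) (Real.cos _ - _)]
    exact this hb ha (le_of_not_ge hab)
  unfold sgnFun
  rw [min_eq_left hab, max_eq_right hab]
  obtain ⟨ha0, haL⟩ := ha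
  obtain ⟨hb0, hbL⟩ := hb
  obtain ⟨hx0, hxL⟩ := hx
  split_ifs with h
  · obtain ⟨h1, h2⟩ := h
    have e1 : Real.cos (π * x / L) - Real.cos (π * a / L) ≤ 0 := by
      linarith [cos_div_antitone hL ha0 h1.le hxL]
    have e2 : 0 ≤ Real.cos (π * x / L) - Real.cos (π * b / L) := by
      linarith [cos_div_antitone hL hx0 h2.le hbL]
    nlinarith [mul_nonpos_iff.mpr (Or.inr ⟨e1, e2⟩)]
  · rw [one_mul]
    rw [Set.mem_Ioo, not_and_or, not_lt, not_lt] at h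
    rcases h with h | h
    · have e1 : 0 ≤ Real.cos (π * x / L) - Real.cos (π * a / L) := by
        linarith [cos_div_antitone hL hx0 h haL]
      have e2 : 0 ≤ Real.cos (π * x / L) - Real.cos (π * b / L) := by
        linarith [cos_div_antitone hL hx0 (h.trans hab) hbL]
      exact mul_nonneg e1 e2
    · have e1 : Real.cos (π * x / L) - Real.cos (π * a / L) ≤ 0 := by
        linarith [cos_div_antitone hL ha0 (hab.trans h) hxL]
      have e2 : Real.cos (π * x / L) - Real.cos (π * b / L) ≤ 0 := by
        linarith [cos_div_antitone hL hb0 h hxL]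
      exact mul_nonneg_of_nonpos_of_nonpos e1 e2

/-- `sin(πt/L) ≥ 0` on `[0, L]`. [folklore] -/
theorem sin_pi_div_nonneg_of_mem (hL : 0 < L) {t : ℝ} (ht : t ∈ Set.Icc 0 L) : 0 ≤ Real.sin (π * t / L) := by
  apply Real.sin_nonneg_of_nonneg_of_le_pi
  · exact div_nonneg (mul_nonneg Real.pi_pos.le ht.1) hL.le
  · rw [div_le_iff₀ hL]; nlinarith [Real.pi_pos, ht.2]

/-- The cosines of an inserted configuration. [folklore] -/
theorem cos_comp_cons (L a : ℝ) (X : Fin n → ℝ) :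
    (fun r : Fin (n + 1) => Real.cos (π * (Fin.cons a X : Fin (n + 1) → ℝ) r / L)) =
      Fin.cons (Real.cos (π * a / L)) fun j => Real.cos (π * X j / L) := by
  ext r
  refine Fin.cases ?_ (fun i => ?_) r <;> simp

/-- The Slater determinant with an inserted first point, factorised. [folklore] -/
theorem det_dSlater_cons (L a : ℝ) (X : Fin n → ℝ) :
    det (dSlater (n + 1) L (Fin.cons a X)) =
      (Real.sin (π * a / L) * ∏ j, Real.sin (π * X j / L)) *
        ((∏ t : Fin (n + 1), (2 : ℝ) ^ (t : ℕ)) *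
          ((∏ j, (Real.cos (π * X j / L) - Real.cos (π * a / L))) *
            det (vandermonde fun j => Real.cos (π * X j / L)))) := by
  rw [det_dSlater, Fin.prod_univ_succ, cos_comp_cons, det_vandermonde_cons]
  simp only [Fin.cons_zero, Fin.cons_succ]

/-- **Girardeau's Bose–Fermi sign identity in the box**: for `a, b ∈ [0, L]` and `X ∈ [0, L]^n`,
`∏_j s(X_j) · det M(a, X) det M(b, X) = |det M(a, X)| |det M(b, X)|`. [cite: ForresterFrankelGaroni2003, §1] -/
theorem sgn_det_det_eq_abs (hL : 0 < L) (ha : a ∈ Set.Icc 0 L) (hb : b ∈ Set.Icc 0 L)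
    (X : Fin n → ℝ) (hX : ∀ j, X j ∈ Set.Icc 0 L) :
    (∏ j, sgnFun a b (X j)) *
        (det (dSlater (n + 1) L (Fin.cons a X)) * det (dSlater (n + 1) L (Fin.cons b X))) =
      |det (dSlater (n + 1) L (Fin.cons a X))| * |det (dSlater (n + 1) L (Fin.cons b X))| := by
  set P : ℝ := det (dSlater (n + 1) L (Fin.cons a X)) * det (dSlater (n + 1) L (Fin.cons b X))
    with hP
  set σ : ℝ := ∏ j, sgnFun a b (X j) with hσ
  have hσ1 : |σ| = 1 := by
    rw [hσ, Finset.abs_prod]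
    simp [abs_sgnFun]
  have hnonneg : 0 ≤ σ * P := by
    set A : ℝ := Real.sin (π * a / L) * ∏ j, Real.sin (π * X j / L) with hA
    set B : ℝ := Real.sin (π * b / L) * ∏ j, Real.sin (π * X j / L) with hB
    set D : ℝ := ∏ t : Fin (n + 1), (2 : ℝ) ^ (t : ℕ) with hD
    set V : ℝ := det (vandermonde fun j => Real.cos (π * X j / L)) with hV
    set Pa : ℝ := ∏ j, (Real.cos (π * X j / L) - Real.cos (π * a / L)) with hPa
    set Pb : ℝ := ∏ j, (Real.cos (π * X j / L) - Real.cos (π * b / L)) with hPb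
    have hA0 : 0 ≤ A := mul_nonneg (sin_pi_div_nonneg_of_mem hL ha)
      (Finset.prod_nonneg fun j _ => sin_pi_div_nonneg_of_mem hL (hX j))
    have hB0 : 0 ≤ B := mul_nonneg (sin_pi_div_nonneg_of_mem hL hb)
      (Finset.prod_nonneg fun j _ => sin_pi_div_nonneg_of_mem hL (hX j))
    have hD0 : 0 ≤ D := Finset.prod_nonneg fun _ _ => by positivity
    have hsP : 0 ≤ σ * (Pa * Pb) := by
      rw [hσ, hPa, hPb, ← Finset.prod_mul_distrib, ← Finset.prod_mul_distrib]
      exact Finset.prod_nonneg fun j _ => sgnFun_mul_cos_sub_nonneg hL ha hb (hX j)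
    have hPeq : P = (A * (D * (Pa * V))) * (B * (D * (Pb * V))) := by
      rw [hP, det_dSlater_cons, det_dSlater_cons]
    calc (0 : ℝ) ≤ (A * B) * (D * D) * (V * V) * (σ * (Pa * Pb)) := by
          have hVV : 0 ≤ V * V := mul_self_nonneg V
          positivity
      _ = σ * P := by rw [hPeq]; ring
  rw [← abs_mul, ← hP, ← abs_of_nonneg hnonneg, abs_mul, hσ1, one_mul]

end Orbitals

/-! ### Part C: Lenard's adjugate formula with Dirichlet orbitals -/

section Lenard

variable {n : ℕ}

/-- The vector of orbital values `f(a)_t = f_t(a)`, `t ≤ n`. [folklore] -/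
def fVec (n : ℕ) (L a : ℝ) : Fin (n + 1) → ℝ := fun t => dOrb L t a

/-- The sign-twisted Gram matrix `G_{tt'} = ∫ s(x) f_t(x) f_{t'}(x) dμ`. [folklore] -/
def gramD (n : ℕ) (μ : Measure ℝ) (L a b : ℝ) : Matrix (Fin (n + 1)) (Fin (n + 1)) ℝ :=
  of fun t t' => ∫ x, sgnFun a b x * dOrb L t x * dOrb L t' x ∂μ

/-- Laplace expansion of the Slater determinant along the inserted point. [folklore] -/
theorem det_dSlater_cons_eq_sum (L a : ℝ) (X : Fin n → ℝ) :
    det (dSlater (n + 1) L (Fin.cons a X)) =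
      ∑ p : Fin (n + 1), ((-1) ^ (p : ℕ) * dOrb L p a) *
        det (of fun r t => dOrb L (p.succAbove t : Fin (n + 1)) (X r)) := by
  rw [det_succ_row_zero]
  refine Finset.sum_congr rfl fun p _ => ?_
  have h0 : dSlater (n + 1) L (Fin.cons a X) 0 p = dOrb L p a := by
    simp [dSlater]
  have h1 : (dSlater (n + 1) L (Fin.cons a X)).submatrix Fin.succ p.succAbove =
      of fun r t => dOrb L (p.succAbove t : Fin (n + 1)) (X r) := by
    ext r t; simp [dSlater]
  rw [h0, h1, mul_assoc]

/-- The twisted Gram integrands are bounded by `1`, hence integrable on a finite measure.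
[folklore] -/
theorem integrable_sgn_dOrb_dOrb (μ : Measure ℝ) [IsFiniteMeasure μ] (L a b : ℝ) (k l : ℕ) :
    Integrable (fun x => sgnFun a b x * dOrb L k x * dOrb L l x) μ := by
  refine Integrable.mono' (integrable_const (1 : ℝ)) ?_ (Filter.Eventually.of_forall fun x => ?_)
  · exact (((measurable_sgnFun a b).mul (continuous_dOrb L k).measurable).mul
      (continuous_dOrb L l).measurable).aestronglyMeasurable
  · rw [Real.norm_eq_abs, abs_mul, abs_mul, abs_sgnFun, one_mul]
    exact mul_le_one₀ (abs_dOrb_le_one L k x) (abs_nonneg _) (abs_dOrb_le_one L l x)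

/-- **Lenard's formula with Dirichlet orbitals (integrated form).** The sign-twisted overlap of
the two Slater determinants is `n!` times the bilinear form of the adjugate of the twisted Gram
matrix. [cite: ForresterFrankelGaroni2003, §3 (the density matrix as a Jacobi-ensemble average)] -/
theorem integral_sgn_det_det_dirichlet (μ : Measure ℝ) [IsFiniteMeasure μ] (L a b : ℝ) :
    ∫ X : Fin n → ℝ, (∏ j, sgnFun a b (X j)) *
        (det (dSlater (n + 1) L (Fin.cons a X)) * det (dSlater (n + 1) L (Fin.cons b X)))
        ∂(Measure.pi fun _ => μ) =
      (n.factorial : ℝ) * (fVec n L b ⬝ᵥ ((gramD n μ L a b).adjugate *ᵥ fVec n L a)) := by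
  -- Step 1: pointwise expansion of the integrand as a double sum over (p, q).
  set F : Fin (n + 1) → Fin n → ℝ → ℝ :=
    fun p t x => sgnFun a b x * dOrb L (p.succAbove t : Fin (n + 1)) x with hF
  set G : Fin (n + 1) → Fin n → ℝ → ℝ :=
    fun q t x => dOrb L (q.succAbove t : Fin (n + 1)) x with hG
  have hexp : ∀ X : Fin n → ℝ,
      (∏ j, sgnFun a b (X j)) *
        (det (dSlater (n + 1) L (Fin.cons a X)) * det (dSlater (n + 1) L (Fin.cons b X))) =
      ∑ p : Fin (n + 1), ∑ q : Fin (n + 1),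
        (((-1) ^ (p : ℕ) * dOrb L p a) * ((-1) ^ (q : ℕ) * dOrb L q b)) *
          (det (of fun r t => F p t (X r)) * det (of fun r t => G q t (X r))) := by
    intro X
    rw [det_dSlater_cons_eq_sum, det_dSlater_cons_eq_sum, Finset.sum_mul_sum, Finset.mul_sum]
    refine Finset.sum_congr rfl fun p _ => ?_
    rw [Finset.mul_sum]
    refine Finset.sum_congr rfl fun q _ => ?_
    have hFdet : (∏ j, sgnFun a b (X j)) *
        det (of fun r t => dOrb L (p.succAbove t : Fin (n + 1)) (X r)) =
        det (of fun r t => F p t (X r)) := by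
      rw [hF, ← det_mul_column]
      rfl
    have hGdet : det (of fun r t => dOrb L (q.succAbove t : Fin (n + 1)) (X r)) =
        det (of fun r t => G q t (X r)) := by
      rw [hG]
    rw [hGdet, ← hFdet]
    ring
  simp_rw [hexp]
  -- Step 2: integrate term by term using Andréief.
  have hFG : ∀ p q : Fin (n + 1), ∀ t t' : Fin n,
      Integrable (fun x => F p t x * G q t' x) μ := by
    intro p q t t'
    simpa [hF, hG, mul_assoc] using integrable_sgn_dOrb_dOrb μ L a b _ _
  have hint : ∀ p q : Fin (n + 1), Integrable (fun X : Fin n → ℝ =>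
      (((-1) ^ (p : ℕ) * dOrb L p a) * ((-1) ^ (q : ℕ) * dOrb L q b)) *
        (det (of fun r t => F p t (X r)) * det (of fun r t => G q t (X r))))
      (Measure.pi fun _ => μ) := fun p q =>
    (integrable_det_mul_det μ (F p) (G q) (hFG p q)).const_mul _
  rw [integral_finsetSum _ fun p _ => integrable_finsetSum _ fun q _ => hint p q]
  simp_rw [integral_finsetSum _ fun q _ => hint _ q, integral_const_mul,
    integral_det_mul_det μ (F _) (G _) (hFG _ _)]
  -- Step 3: identify the cofactors.
  have hsub : ∀ p q : Fin (n + 1),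
      (of fun t t' => ∫ x, F p t x * G q t' x ∂μ) =
        (gramD n μ L a b).submatrix p.succAbove q.succAbove := by
    intro p q
    ext t t'
    simp only [gramD, of_apply, submatrix_apply, hF, hG, mul_assoc]
  simp_rw [hsub]
  have hadj : ∀ p q : Fin (n + 1),
      (gramD n μ L a b).adjugate q p =
        (-1) ^ ((p : ℕ) + (q : ℕ)) * det ((gramD n μ L a b).submatrix p.succAbove q.succAbove) :=
    fun p q => adjugate_fin_succ_eq_det_submatrix _ _ _
  -- Step 4: rewrite the bilinear form.
  simp only [dotProduct, mulVec, fVec, hadj, Finset.mul_sum]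
  rw [Finset.sum_comm]
  refine Finset.sum_congr rfl fun q _ => Finset.sum_congr rfl fun p _ => ?_
  rw [pow_add]
  ring

end Lenard

/-! ### Part E: orthogonality of the Dirichlet orbitals and the Gram matrix in closed form -/

section Gram

variable {n : ℕ} {L a b : ℝ}

/-- `∫ᵤᵛ cos(mπx/L) dx = (L/(mπ)) (sin(mπv/L) − sin(mπu/L))` for `m ≠ 0`. [folklore] -/
theorem integral_cos_mul (hL : 0 < L) {m : ℝ} (hm : m ≠ 0) (u v : ℝ) :
    ∫ x in u..v, Real.cos (m * π * x / L) =
      L / (m * π) * (Real.sin (m * π * v / L) - Real.sin (m * π * u / L)) := by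
  set c : ℝ := m * π / L with hc
  have hc0 : c ≠ 0 := by
    rw [hc]; exact div_ne_zero (mul_ne_zero hm Real.pi_pos.ne') hL.ne'
  have hderiv : ∀ x ∈ Set.uIcc u v,
      HasDerivAt (fun x => Real.sin (c * x) / c) (Real.cos (m * π * x / L)) x := by
    intro x _
    have h1 : HasDerivAt (fun x => c * x) c x := by
      simpa using (hasDerivAt_id x).const_mul c
    have h2 := (h1.sin).div_const c
    refine h2.congr_deriv ?_
    rw [mul_div_assoc, div_self hc0, mul_one, hc]
    congr 1; ring
  have hcont : IntervalIntegrable (fun x => Real.cos (m * π * x / L)) volume u v :=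
    (by fun_prop : Continuous fun x => Real.cos (m * π * x / L)).intervalIntegrable _ _
  rw [intervalIntegral.integral_eq_sub_of_hasDerivAt hderiv hcont]
  rw [show c * v = m * π * v / L by rw [hc]; ring, show c * u = m * π * u / L by rw [hc]; ring, hc]
  field_simp

/-- `∫₀ᴸ cos(mπx/L) dx = L·[m = 0]` for integer `m`. [folklore] -/
theorem integral_cos_int_mul (hL : 0 < L) (m : ℤ) :
    ∫ x in Set.Icc 0 L, Real.cos (m * π * x / L) = if m = 0 then L else 0 := by
  rw [integral_Icc_eq_integral_Ioc, ← intervalIntegral.integral_of_le hL.le]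
  split_ifs with hm
  · simp [hm]
  · have hm' : (m : ℝ) ≠ 0 := by exact_mod_cast hm
    rw [integral_cos_mul hL hm' 0 L]
    rw [show (m : ℝ) * π * L / L = m * π by field_simp, Real.sin_int_mul_pi]
    simp

/-- Product-to-sum: `f_k f_l = (cos((k−l)θ) − cos((k+l+2)θ))/2`. [folklore] -/
theorem dOrb_mul_dOrb (L : ℝ) (k l : ℕ) (x : ℝ) :
    dOrb L k x * dOrb L l x =
      (Real.cos ((((k : ℤ) - l : ℤ) : ℝ) * π * x / L) -
        Real.cos ((((k : ℤ) + l + 2 : ℤ) : ℝ) * π * x / L)) / 2 := by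
  unfold dOrb
  have hA : (((k : ℤ) - l : ℤ) : ℝ) * π * x / L =
      ((k : ℝ) + 1) * π * x / L - ((l : ℝ) + 1) * π * x / L := by push_cast; ring
  have hB : (((k : ℤ) + l + 2 : ℤ) : ℝ) * π * x / L =
      ((k : ℝ) + 1) * π * x / L + ((l : ℝ) + 1) * π * x / L := by push_cast; ring
  rw [hA, hB, Real.cos_sub, Real.cos_add]
  ring

/-- **Orthogonality** of the Dirichlet orbitals: `∫₀ᴸ f_k f_l = (L/2) δ_{kl}`. [folklore] -/
theorem integral_dOrb_mul_dOrb (hL : 0 < L) (k l : ℕ) :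
    ∫ x in Set.Icc 0 L, dOrb L k x * dOrb L l x = if k = l then L / 2 else 0 := by
  simp_rw [dOrb_mul_dOrb]
  have hc : ∀ m : ℤ, IntegrableOn (fun x => Real.cos ((m : ℝ) * π * x / L)) (Set.Icc 0 L) :=
    fun m => (by fun_prop : Continuous fun x => Real.cos ((m : ℝ) * π * x / L)).integrableOn_Icc
  rw [integral_div, integral_sub (hc _) (hc _), integral_cos_int_mul hL, integral_cos_int_mul hL]
  have h2 : ((k : ℤ) + l + 2 : ℤ) ≠ 0 := by omega
  rw [if_neg h2]
  by_cases hkl : k = l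
  · subst hkl; simp
  · rw [if_neg (by omega : ((k : ℤ) - l : ℤ) ≠ 0), if_neg hkl]; simp

/-- The arc overlap `Q_{kl} = (2/L) ∫_{(min a b, max a b)} f_k f_l` of the normalised orbitals
(the compression of the projection onto the arc between `a` and `b` to the span of the first
orbitals). [folklore] -/
def qD (L a b : ℝ) (k l : ℕ) : ℝ :=
  2 / L * ∫ x in Set.Ioo (min a b) (max a b), dOrb L k x * dOrb L l x

/-- Lenard's matrix with Dirichlet orbitals, `1 − 2Q`. [folklore] -/
def dirichletMatrix (n : ℕ) (L a b : ℝ) : Matrix (Fin (n + 1)) (Fin (n + 1)) ℝ :=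
  of fun k l => (if k = l then (1 : ℝ) else 0) - 2 * qD L a b k l

/-- Entries of the twisted Gram matrix over `[0, L]`: `∫₀ᴸ s f_k f_l = (L/2)(δ_{kl} − 2Q_{kl})`.
[folklore] -/
theorem gramD_entry (hL : 0 < L) (ha : a ∈ Set.Icc 0 L) (hb : b ∈ Set.Icc 0 L) (k l : ℕ) :
    ∫ x in Set.Icc 0 L, sgnFun a b x * dOrb L k x * dOrb L l x =
      L / 2 * ((if k = l then (1 : ℝ) else 0) - 2 * qD L a b k l) := by
  have hrew : ∀ x, sgnFun a b x * dOrb L k x * dOrb L l x =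
      dOrb L k x * dOrb L l x -
        2 * (Set.Ioo (min a b) (max a b)).indicator (fun x => dOrb L k x * dOrb L l x) x := by
    intro x
    unfold sgnFun
    by_cases hx : x ∈ Set.Ioo (min a b) (max a b)
    · rw [if_pos hx, Set.indicator_of_mem hx]; ring
    · rw [if_neg hx, Set.indicator_of_notMem hx]; ring
  have hint : IntegrableOn (fun x => dOrb L k x * dOrb L l x) (Set.Icc 0 L) :=
    ((continuous_dOrb L k).mul (continuous_dOrb L l)).integrableOn_Icc
  simp_rw [hrew]
  rw [integral_sub hint ((hint.indicator measurableSet_Ioo).const_mul _), integral_const_mul,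
    setIntegral_indicator measurableSet_Ioo,
    Set.inter_eq_self_of_subset_right (Ioo_subset_Icc_of_mem ha hb), integral_dOrb_mul_dOrb hL]
  unfold qD
  have hL0 : L ≠ 0 := hL.ne'
  split_ifs
  · field_simp
  · field_simp; ring

/-- The twisted Gram matrix over `[0, L]` is `(L/2) · (1 − 2Q)`. [folklore] -/
theorem gramD_eq_smul (hL : 0 < L) (ha : a ∈ Set.Icc 0 L) (hb : b ∈ Set.Icc 0 L) :
    gramD n (volume.restrict (Set.Icc 0 L)) L a b = (L / 2) • dirichletMatrix n L a b := by
  ext k l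
  simp only [gramD, dirichletMatrix, of_apply, Matrix.smul_apply, smul_eq_mul]
  rw [gramD_entry hL ha hb]
  simp only [Fin.val_inj]

/-- **Lenard's formula in the box.** For `a, b ∈ [0, L]`,
`ρ^D_{n+1}(a, b) = (2/L) ⟨f(b), adj(1 − 2Q) f(a)⟩`. [cite: ForresterFrankelGaroni2003, §3] -/
theorem dirichletDensity_eq_adjugate (hL : 0 < L) (ha : a ∈ Set.Icc 0 L) (hb : b ∈ Set.Icc 0 L) :
    dirichletDensityMatrix (n + 1) L a b =
      2 / L * (fVec n L b ⬝ᵥ ((dirichletMatrix n L a b).adjugate *ᵥ fVec n L a)) := by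
  have hdef : dirichletDensityMatrix (n + 1) L a b = (n + 1 : ℝ) *
      ∫ X in Set.pi Set.univ (fun _ : Fin n => Set.Icc (0 : ℝ) L),
        dirichletState (n + 1) L (Fin.cons a X) * dirichletState (n + 1) L (Fin.cons b X) := rfl
  rw [hdef]
  have hS : MeasurableSet (Set.pi Set.univ fun _ : Fin n => Set.Icc (0 : ℝ) L) :=
    MeasurableSet.univ_pi fun _ => measurableSet_Icc
  set C2 : ℝ := ((n + 1).factorial : ℝ) * (L / 2) ^ (n + 1) with hC2def
  have hC2pos : 0 < C2 := by positivity
  have hpt : ∀ X ∈ Set.pi Set.univ (fun _ : Fin n => Set.Icc (0 : ℝ) L),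
      dirichletState (n + 1) L (Fin.cons a X) * dirichletState (n + 1) L (Fin.cons b X) =
      C2⁻¹ * ((∏ j, sgnFun a b (X j)) *
        (det (dSlater (n + 1) L (Fin.cons a X)) * det (dSlater (n + 1) L (Fin.cons b X)))) := by
    intro X hX
    have hX' : ∀ j, X j ∈ Set.Icc 0 L := fun j => hX j (Set.mem_univ _)
    rw [sgn_det_det_eq_abs hL ha hb X hX']
    unfold dirichletState
    have hs : (Real.sqrt C2)⁻¹ * (Real.sqrt C2)⁻¹ = C2⁻¹ := by
      rw [← mul_inv, Real.mul_self_sqrt hC2pos.le]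
    rw [← hC2def]
    calc (Real.sqrt C2)⁻¹ * |det (dSlater (n + 1) L (Fin.cons a X))| *
          ((Real.sqrt C2)⁻¹ * |det (dSlater (n + 1) L (Fin.cons b X))|)
        = ((Real.sqrt C2)⁻¹ * (Real.sqrt C2)⁻¹) *
            (|det (dSlater (n + 1) L (Fin.cons a X))| *
              |det (dSlater (n + 1) L (Fin.cons b X))|) := by ring
      _ = C2⁻¹ * (|det (dSlater (n + 1) L (Fin.cons a X))| *
              |det (dSlater (n + 1) L (Fin.cons b X))|) := by rw [hs]
  rw [setIntegral_congr_fun hS hpt, integral_const_mul]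
  have hμ : (volume : Measure (Fin n → ℝ)).restrict (Set.pi Set.univ fun _ => Set.Icc (0 : ℝ) L) =
      Measure.pi fun _ : Fin n => (volume : Measure ℝ).restrict (Set.Icc 0 L) := by
    rw [volume_pi, Measure.restrict_pi_pi]
  rw [hμ, integral_sgn_det_det_dirichlet, gramD_eq_smul hL ha hb, adjugate_smul, Fintype.card_fin,
    Nat.add_sub_cancel, smul_mulVec, dotProduct_smul, smul_eq_mul]
  set B : ℝ := fVec n L b ⬝ᵥ ((dirichletMatrix n L a b).adjugate *ᵥ fVec n L a)
  rw [hC2def, Nat.factorial_succ]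
  push_cast
  have hL0 : L ≠ 0 := hL.ne'
  have hnf : (n.factorial : ℝ) ≠ 0 := by exact_mod_cast Nat.factorial_ne_zero n
  field_simp
  ring

end Gram

/-! ### Part F: the adjugate bound (complexification of the real symmetric Lenard matrix) -/

section Bound

variable {n : ℕ} {L a b : ℝ}

/-- `Q` is symmetric. [folklore] -/
theorem qD_comm (L a b : ℝ) (k l : ℕ) : qD L a b k l = qD L a b l k := by
  unfold qD
  congr 1
  refine setIntegral_congr_fun measurableSet_Ioo fun x _ => ?_
  ring

/-- Lenard's Dirichlet matrix is symmetric. [folklore] -/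
theorem dirichletMatrix_apply_comm (n : ℕ) (L a b : ℝ) (k l : Fin (n + 1)) :
    dirichletMatrix n L a b k l = dirichletMatrix n L a b l k := by
  simp only [dirichletMatrix, of_apply]
  rw [qD_comm L a b k l]
  by_cases h : k = l
  · subst h; rfl
  · rw [if_neg h, if_neg (Ne.symm h)]

/-- The number variance `V = tr Q − ‖Q‖²_F` of the arc for the Dirichlet free fermions
(indices `0, …, N−1` label the lowest `N` orbitals). [folklore] -/
def dNumVar (N : ℕ) (L a b : ℝ) : ℝ :=
  ∑ k ∈ Finset.range N, qD L a b k k -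
    ∑ k ∈ Finset.range N, ∑ l ∈ Finset.range N, qD L a b k l ^ 2

/-- `‖1 − 2Q‖²_F − N = −4 V`. [folklore] -/
theorem sum_sq_dirichletMatrix (n : ℕ) (L a b : ℝ) :
    ∑ k : Fin (n + 1), ∑ l : Fin (n + 1), dirichletMatrix n L a b k l ^ 2 - (n + 1 : ℕ) =
      -4 * dNumVar (n + 1) L a b := by
  have hentry : ∀ k l : Fin (n + 1), dirichletMatrix n L a b k l ^ 2 =
      (if k = l then 1 - 4 * qD L a b k k else 0) + 4 * qD L a b k l ^ 2 := by
    intro k l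
    simp only [dirichletMatrix, of_apply]
    by_cases h : k = l
    · subst h; simp only [if_true]; ring
    · rw [if_neg h, if_neg h]; ring
  simp_rw [hentry, Finset.sum_add_distrib, Finset.sum_ite_eq, Finset.mem_univ, if_true,
    Finset.sum_sub_distrib, Finset.sum_const, Finset.card_univ, Fintype.card_fin,
    nsmul_eq_mul, mul_one, ← Finset.mul_sum]
  unfold dNumVar
  rw [← Fin.sum_univ_eq_sum_range (fun k => qD L a b k k) (n + 1),
    ← Fin.sum_univ_eq_sum_range (fun k => ∑ l ∈ Finset.range (n + 1), qD L a b k l ^ 2) (n + 1)]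
  simp_rw [← Fin.sum_univ_eq_sum_range (fun l => qD L a b _ l ^ 2) (n + 1)]
  push_cast
  ring

/-- `‖f(a)‖² ≤ n + 1`. [folklore] -/
theorem sum_sq_fVec_le (n : ℕ) (L a : ℝ) : ∑ t, fVec n L a t ^ 2 ≤ (n + 1 : ℝ) := by
  calc ∑ t, fVec n L a t ^ 2 ≤ ∑ _t : Fin (n + 1), (1 : ℝ) := by
        refine Finset.sum_le_sum fun t _ => ?_
        have h := abs_dOrb_le_one L t a
        rw [fVec, ← sq_abs]
        nlinarith [abs_nonneg (dOrb L t a)]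
    _ = (n + 1 : ℝ) := by simp

/-- **The adjugate bound for Lenard's Dirichlet matrix**:
`|⟨f(b), adj(1 − 2Q) f(a)⟩| ≤ e^{1/2} e^{−2V} (n+1)` (spectral bound for the complexified,
Hermitian matrix). [folklore] -/
theorem abs_fVec_adjugate_le (n : ℕ) (L a b : ℝ) :
    |fVec n L b ⬝ᵥ ((dirichletMatrix n L a b).adjugate *ᵥ fVec n L a)| ≤
      Real.exp (1 / 2) * Real.exp (-2 * dNumVar (n + 1) L a b) * (n + 1) := by
  set D := dirichletMatrix n L a b with hD
  set f : ℝ →+* ℂ := algebraMap ℝ ℂ with hf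
  have hfc : ⇑f = ((↑) : ℝ → ℂ) := by rw [hf]; exact Complex.coe_algebraMap
  set Dc : Matrix (Fin (n + 1)) (Fin (n + 1)) ℂ := f.mapMatrix D with hDc
  have hDc_apply : ∀ i j, Dc i j = ((D i j : ℝ) : ℂ) := by
    intro i j; rw [hDc, RingHom.mapMatrix_apply, Matrix.map_apply, hfc]
  have hHerm : Dc.IsHermitian := by
    refine Matrix.IsHermitian.ext fun i j => ?_
    rw [hDc_apply, hDc_apply, Complex.star_def, Complex.conj_ofReal, hD,
      dirichletMatrix_apply_comm]
  set x : Fin (n + 1) → ℂ := f ∘ fVec n L b with hx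
  set y : Fin (n + 1) → ℂ := f ∘ fVec n L a with hy
  have h := norm_star_dotProduct_adjugate_mulVec_le hHerm x y
  -- the left-hand side is the real bilinear form
  have hlhs : star x ⬝ᵥ (Dc.adjugate *ᵥ y) = f (fVec n L b ⬝ᵥ (D.adjugate *ᵥ fVec n L a)) := by
    have h1 : Dc.adjugate = f.mapMatrix D.adjugate := by
      rw [hDc, RingHom.map_adjugate]
    have h2 : Dc.adjugate *ᵥ y = f ∘ (D.adjugate *ᵥ fVec n L a) := by
      ext i
      rw [h1, Function.comp_apply, RingHom.map_mulVec, RingHom.mapMatrix_apply, hy]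
    have hstar : star x = x := by
      ext t
      simp only [hx, Pi.star_apply, Function.comp_apply, hfc, Complex.star_def,
        Complex.conj_ofReal]
    rw [hstar, h2, RingHom.map_dotProduct, hx]
  have hnorm : ‖star x ⬝ᵥ (Dc.adjugate *ᵥ y)‖ =
      |fVec n L b ⬝ᵥ (D.adjugate *ᵥ fVec n L a)| := by
    rw [hlhs, hfc, Complex.norm_real, Real.norm_eq_abs]
  -- the trace term
  have htrace : Complex.re (Dc * Dc).trace = ∑ k, ∑ l, D k l ^ 2 := by
    simp only [Matrix.trace, Matrix.diag, Matrix.mul_apply, Complex.re_sum, hDc_apply,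
      ← Complex.ofReal_mul, Complex.ofReal_re]
    refine Finset.sum_congr rfl fun k _ => Finset.sum_congr rfl fun l _ => ?_
    rw [hD, dirichletMatrix_apply_comm n L a b l k, sq]
  have hexp : Real.exp ((Complex.re (Dc * Dc).trace - Fintype.card (Fin (n + 1))) / 2) =
      Real.exp (-2 * dNumVar (n + 1) L a b) := by
    rw [htrace, Fintype.card_fin, hD, sum_sq_dirichletMatrix]
    congr 1; ring
  -- the norms of the vectors
  have hxn : ∑ i, ‖x i‖ ^ 2 = ∑ t, fVec n L b t ^ 2 := by
    refine Finset.sum_congr rfl fun t _ => ?_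
    rw [hx, Function.comp_apply, hfc, Complex.norm_real, Real.norm_eq_abs, sq_abs]
  have hyn : ∑ i, ‖y i‖ ^ 2 = ∑ t, fVec n L a t ^ 2 := by
    refine Finset.sum_congr rfl fun t _ => ?_
    rw [hy, Function.comp_apply, hfc, Complex.norm_real, Real.norm_eq_abs, sq_abs]
  have hsqrt : Real.sqrt (∑ i, ‖x i‖ ^ 2) * Real.sqrt (∑ i, ‖y i‖ ^ 2) ≤ (n + 1 : ℝ) := by
    rw [hxn, hyn]
    calc Real.sqrt (∑ t, fVec n L b t ^ 2) * Real.sqrt (∑ t, fVec n L a t ^ 2)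
        ≤ Real.sqrt (n + 1) * Real.sqrt (n + 1) := by
          gcongr
          · exact sum_sq_fVec_le n L b
          · exact sum_sq_fVec_le n L a
      _ = (n + 1 : ℝ) := Real.mul_self_sqrt (by positivity)
  rw [hnorm, hexp] at h
  refine h.trans ?_
  exact mul_le_mul_of_nonneg_left hsqrt (by positivity)

/-- **The density-matrix bound in the box.** For `a, b ∈ [0, L]`,
`ρ^D_{n+1}(a, b) ≤ (2(n+1)/L) e^{1/2} exp(−2 V_{n+1}(a, b))`. [folklore] -/
theorem dirichletDensity_le_exp_numVar (hL : 0 < L) (ha : a ∈ Set.Icc 0 L)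
    (hb : b ∈ Set.Icc 0 L) :
    dirichletDensityMatrix (n + 1) L a b ≤
      2 * (n + 1 : ℝ) / L * Real.exp (1 / 2) * Real.exp (-2 * dNumVar (n + 1) L a b) := by
  rw [dirichletDensity_eq_adjugate hL ha hb]
  have h := abs_fVec_adjugate_le n L a b
  have h2L : 0 ≤ 2 / L := by positivity
  calc 2 / L * (fVec n L b ⬝ᵥ ((dirichletMatrix n L a b).adjugate *ᵥ fVec n L a))
      ≤ 2 / L * |fVec n L b ⬝ᵥ ((dirichletMatrix n L a b).adjugate *ᵥ fVec n L a)| :=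
        mul_le_mul_of_nonneg_left (le_abs_self _) h2L
    _ ≤ 2 / L * (Real.exp (1 / 2) * Real.exp (-2 * dNumVar (n + 1) L a b) * (n + 1)) :=
        mul_le_mul_of_nonneg_left h h2L
    _ = 2 * (n + 1 : ℝ) / L * Real.exp (1 / 2) * Real.exp (-2 * dNumVar (n + 1) L a b) := by
        ring

end Bound

/-! ### Part G: Bessel's inequality for the sine system; logarithmic divergence of the variance -/

section Variance

variable {L a b : ℝ}

/-- Fourier–cosine coefficient of the arc indicator, `c(m) = L⁻¹ ∫_{(min a b, max a b)} cos(mπx/L) dx`.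
[folklore] -/
def cD (L a b : ℝ) (m : ℤ) : ℝ :=
  1 / L * ∫ x in Set.Ioo (min a b) (max a b), Real.cos (m * π * x / L)

/-- `Q_{kl} = c(k − l) − c(k + l + 2)` (product-to-sum). [folklore] -/
theorem qD_eq_cD (hL : 0 < L) (k l : ℕ) :
    qD L a b k l = cD L a b ((k : ℤ) - l) - cD L a b ((k : ℤ) + l + 2) := by
  unfold qD cD
  simp_rw [dOrb_mul_dOrb]
  have hc : ∀ m : ℤ, IntegrableOn (fun x => Real.cos ((m : ℝ) * π * x / L))
      (Set.Ioo (min a b) (max a b)) := fun m =>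
    (by fun_prop : Continuous fun x => Real.cos ((m : ℝ) * π * x / L)).integrableOn_Icc.mono_set
      Set.Ioo_subset_Icc_self
  rw [integral_div, integral_sub (hc _) (hc _)]
  have hL0 : L ≠ 0 := hL.ne'
  field_simp

/-- `c` is even. [folklore] -/
theorem cD_neg (L a b : ℝ) (m : ℤ) : cD L a b (-m) = cD L a b m := by
  unfold cD
  congr 1
  refine setIntegral_congr_fun measurableSet_Ioo fun x _ => ?_
  push_cast
  rw [show -(m : ℝ) * π * x / L = -((m : ℝ) * π * x / L) by ring, Real.cos_neg]

/-- Closed form: `c(m) = (sin(mβ) − sin(mα))/(mπ)` for `m ≠ 0`, `α = π min(a,b)/L`,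
`β = π max(a,b)/L`. [folklore] -/
theorem cD_eq (hL : 0 < L) {m : ℤ} (hm : m ≠ 0) :
    cD L a b m =
      (Real.sin (m * π * max a b / L) - Real.sin (m * π * min a b / L)) / (m * π) := by
  unfold cD
  have hm' : (m : ℝ) ≠ 0 := by exact_mod_cast hm
  rw [← integral_Ioc_eq_integral_Ioo, ← intervalIntegral.integral_of_le min_le_max,
    integral_cos_mul hL hm']
  have hL0 : L ≠ 0 := hL.ne'
  have hmπ : (m : ℝ) * π ≠ 0 := mul_ne_zero hm' Real.pi_pos.ne'
  field_simp

/-- `|c(m)| ≤ 2/(|m|π)` for `m ≠ 0`. [folklore] -/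
theorem abs_cD_le (hL : 0 < L) {m : ℤ} (hm : m ≠ 0) :
    |cD L a b m| ≤ 2 / (|(m : ℝ)| * π) := by
  rw [cD_eq hL hm, abs_div, abs_mul, abs_of_pos Real.pi_pos]
  have hpos : 0 < |(m : ℝ)| * π := by
    have : (0 : ℝ) < |(m : ℝ)| := abs_pos.mpr (by exact_mod_cast hm)
    positivity
  apply div_le_div_of_nonneg_right _ hpos.le
  calc |Real.sin (m * π * max a b / L) - Real.sin (m * π * min a b / L)|
      ≤ |Real.sin (m * π * max a b / L)| + |Real.sin (m * π * min a b / L)| := abs_sub _ _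
    _ ≤ 1 + 1 := add_le_add (Real.abs_sin_le_one _) (Real.abs_sin_le_one _)
    _ = 2 := by norm_num

/-- **Bessel's inequality** for the orthonormal sine system `√(2/L) f_l` on `[0, L]`, applied to
`√(2/L) f_k · 𝟙_{arc}`: `∑_{l ∈ T} Q_{kl}² ≤ Q_{kk}` for every finite `T`. [folklore] -/
theorem sum_sq_qD_le (hL : 0 < L) (ha : a ∈ Set.Icc 0 L) (hb : b ∈ Set.Icc 0 L) (k : ℕ)
    (T : Finset ℕ) :
    ∑ l ∈ T, qD L a b k l ^ 2 ≤ qD L a b k k := by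
  set I0 := Set.Ioo (min a b) (max a b) with hI0
  set q : ℕ → ℝ := fun l => qD L a b k l with hq
  set B : ℝ := ∑ l ∈ T, q l ^ 2 with hB
  set g : ℝ → ℝ := fun x => ∑ l ∈ T, q l * dOrb L l x with hg
  have hsub : I0 ⊆ Set.Icc 0 L := Ioo_subset_Icc_of_mem ha hb
  have hg_cont : Continuous g :=
    continuous_finsetSum _ fun l _ => continuous_const.mul (continuous_dOrb L l)
  have hff : ∀ (i j : ℕ) (s : Set ℝ), s ⊆ Set.Icc 0 L →
      IntegrableOn (fun x => dOrb L i x * dOrb L j x) s := fun i j s hs =>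
    (((continuous_dOrb L i).mul (continuous_dOrb L j)).integrableOn_Icc).mono_set hs
  -- (i) `(2/L) ∫_{I0} f_k g = B`
  have h1 : 2 / L * ∫ x in I0, dOrb L k x * g x = B := by
    have hx : ∀ x, dOrb L k x * g x = ∑ l ∈ T, q l * (dOrb L k x * dOrb L l x) := by
      intro x
      rw [hg]
      simp only [Finset.mul_sum]
      refine Finset.sum_congr rfl fun l _ => ?_
      ring
    simp_rw [hx]
    rw [integral_finsetSum _ fun l _ => ((hff k l I0 hsub).const_mul (q l))]
    simp_rw [integral_const_mul]
    rw [hB, Finset.mul_sum]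
    refine Finset.sum_congr rfl fun l _ => ?_
    rw [hq]
    unfold qD
    ring
  -- (ii) `(2/L) ∫_{[0,L]} g² = B`
  have h2 : 2 / L * ∫ x in Set.Icc 0 L, g x ^ 2 = B := by
    have hx : ∀ x, g x ^ 2 = ∑ l ∈ T, ∑ l' ∈ T, (q l * q l') * (dOrb L l x * dOrb L l' x) := by
      intro x
      rw [hg, sq, Finset.sum_mul_sum]
      refine Finset.sum_congr rfl fun l _ => Finset.sum_congr rfl fun l' _ => ?_
      ring
    simp_rw [hx]
    rw [integral_finsetSum _ fun l _ => integrable_finsetSum _ fun l' _ =>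
      (hff l l' _ subset_rfl).const_mul _]
    simp_rw [integral_finsetSum _ fun l' _ => (hff _ l' _ subset_rfl).const_mul _,
      integral_const_mul, integral_dOrb_mul_dOrb hL, mul_ite, mul_zero, Finset.sum_ite_eq]
    rw [Finset.mul_sum, hB]
    refine Finset.sum_congr rfl fun l hl => ?_
    rw [if_pos hl]
    have hL0 : L ≠ 0 := hL.ne'
    field_simp
  -- (iii) the chain of inequalities
  have hgI : IntegrableOn (fun x => dOrb L k x * g x) I0 :=
    (((continuous_dOrb L k).mul hg_cont).integrableOn_Icc).mono_set hsub
  have hg2 : IntegrableOn (fun x => g x ^ 2) (Set.Icc 0 L) := (hg_cont.pow 2).integrableOn_Icc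
  have hg2I : IntegrableOn (fun x => g x ^ 2) I0 := hg2.mono_set hsub
  have hfk2I : IntegrableOn (fun x => dOrb L k x ^ 2) I0 :=
    (((continuous_dOrb L k).pow 2).integrableOn_Icc).mono_set hsub
  have hqkk : qD L a b k k = 2 / L * ∫ x in I0, dOrb L k x ^ 2 := by
    unfold qD
    congr 1
    refine setIntegral_congr_fun measurableSet_Ioo fun x _ => ?_
    ring
  have h2L : 0 ≤ 2 / L := by positivity
  have hchain : B ≤ qD L a b k k / 2 + B / 2 := by
    calc B = 2 / L * ∫ x in I0, dOrb L k x * g x := h1.symm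
      _ ≤ 2 / L * ∫ x in I0, (dOrb L k x ^ 2 + g x ^ 2) / 2 := by
          apply mul_le_mul_of_nonneg_left _ h2L
          refine integral_mono hgI ((hfk2I.add hg2I).div_const _) fun x => ?_
          simp only
          nlinarith [sq_nonneg (dOrb L k x - g x)]
      _ = 2 / L * ((∫ x in I0, dOrb L k x ^ 2) / 2 + (∫ x in I0, g x ^ 2) / 2) := by
          rw [integral_div, integral_add hfk2I hg2I, add_div]
      _ ≤ 2 / L * ((∫ x in I0, dOrb L k x ^ 2) / 2 + (∫ x in Set.Icc 0 L, g x ^ 2) / 2) := by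
          have hmono : ∫ x in I0, g x ^ 2 ≤ ∫ x in Set.Icc 0 L, g x ^ 2 :=
            setIntegral_mono_set hg2 (Filter.Eventually.of_forall fun x => sq_nonneg _)
              hsub.eventuallyLE
          exact mul_le_mul_of_nonneg_left (by linarith) h2L
      _ = qD L a b k k / 2 + B / 2 := by rw [hqkk, ← h2]; ring
  linarith

/-- The off-diagonal block `{N−K ≤ k < N} × {N ≤ l < N+K}` of `Q²` is dominated by the number
variance: `V_N ≥ ∑_{i,j<K} Q_{N−1−i, N+j}²` for `K ≤ N` (Bessel, row by row). [folklore] -/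
theorem block_le_dNumVar (hL : 0 < L) (ha : a ∈ Set.Icc 0 L) (hb : b ∈ Set.Icc 0 L) {N K : ℕ}
    (hK : K ≤ N) :
    ∑ i ∈ range K, ∑ j ∈ range K, qD L a b (N - 1 - i) (N + j) ^ 2 ≤ dNumVar N L a b := by
  have hrow : ∀ k ∈ range N, ∑ l ∈ range N, qD L a b k l ^ 2 +
      ∑ j ∈ range K, qD L a b k (N + j) ^ 2 ≤ qD L a b k k := by
    intro k _
    have h := sum_sq_qD_le hL ha hb k (range N ∪ (range K).image fun j => N + j)
    have hdisj : Disjoint (range N) ((range K).image fun j => N + j) := by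
      rw [Finset.disjoint_left]
      intro l hl hl'
      simp only [Finset.mem_image, Finset.mem_range] at hl hl'
      obtain ⟨j, _, rfl⟩ := hl'
      omega
    rw [Finset.sum_union hdisj, Finset.sum_image] at h
    · exact h
    · intro x _ y _ hxy; simp only at hxy; omega
  have hsum := Finset.sum_le_sum hrow
  rw [Finset.sum_add_distrib] at hsum
  have hre : ∑ i ∈ range K, ∑ j ∈ range K, qD L a b (N - 1 - i) (N + j) ^ 2 ≤
      ∑ k ∈ range N, ∑ j ∈ range K, qD L a b k (N + j) ^ 2 := by
    rw [← Finset.sum_image (s := range K) (g := fun i => N - 1 - i)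
      (f := fun k => ∑ j ∈ range K, qD L a b k (N + j) ^ 2)]
    · apply Finset.sum_le_sum_of_subset_of_nonneg
      · intro k hk
        simp only [Finset.mem_image, Finset.mem_range] at hk ⊢
        obtain ⟨i, hi, rfl⟩ := hk
        omega
      · intro k _ _
        exact Finset.sum_nonneg fun j _ => sq_nonneg _
    · intro x hx y hy hxy
      simp only [Finset.coe_range, Set.mem_Iio] at hx hy
      simp only at hxy
      omega
  unfold dNumVar
  linarith

/-- Entries of the block in closed form: `Q_{N−1−i, N+j} = c(i+j+1) − c(2N+1+j−i)`. [folklore] -/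
theorem qD_block_eq (hL : 0 < L) {N i : ℕ} (j : ℕ) (hi : i < N) :
    qD L a b (N - 1 - i) (N + j) = cD L a b ((i : ℤ) + j + 1) - cD L a b (2 * (N : ℤ) + 1 + j - i) := by
  rw [qD_eq_cD hL]
  have e1 : ((N - 1 - i : ℕ) : ℤ) - ((N + j : ℕ) : ℤ) = -((i : ℤ) + j + 1) := by omega
  have e2 : ((N - 1 - i : ℕ) : ℤ) + ((N + j : ℕ) : ℤ) + 2 = 2 * (N : ℤ) + 1 + j - i := by omega
  rw [e1, e2, cD_neg]

/-- `(p − 2Aq + r)² ≤ 3p² + 12q² + 3r²` for `A² ≤ 1` (Cauchy–Schwarz). [folklore] -/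
theorem sq_comb_le (p q r A : ℝ) (hA : A ^ 2 ≤ 1) :
    (p - 2 * A * q + r) ^ 2 ≤ 3 * p ^ 2 + 12 * q ^ 2 + 3 * r ^ 2 := by
  nlinarith [sq_nonneg (p + 2 * A * q), sq_nonneg (2 * A * q + r), sq_nonneg (p - r),
    mul_le_mul_of_nonneg_right hA (sq_nonneg q)]

/-- Algebraic core of the four-block lemma. [folklore] -/
theorem four_block_core {W0 W1 W2 W3 A B s1 s2 t1 t2 sa sb : ℝ}
    (hu0 : W2 - 2 * A * W1 + W0 = 2 * (B - A) * s1)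
    (hu1 : W3 - 2 * A * W2 + W1 = 2 * (B - A) * s2)
    (hv0 : W2 - 2 * B * W1 + W0 = 2 * (B - A) * t1)
    (hv1 : W3 - 2 * B * W2 + W1 = 2 * (B - A) * t2)
    (hsb : sb ^ 2 ≤ 2 * (s1 ^ 2 + s2 ^ 2)) (hsa : sa ^ 2 ≤ 2 * (t1 ^ 2 + t2 ^ 2))
    (hA : A ^ 2 ≤ 1) (hB : B ^ 2 ≤ 1) :
    (B - A) ^ 2 * (sa ^ 2 + sb ^ 2) / 15 ≤ W0 ^ 2 + W1 ^ 2 + W2 ^ 2 + W3 ^ 2 := by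
  have hcs0 := sq_comb_le W2 W1 W0 A hA
  have hcs1 := sq_comb_le W3 W2 W1 A hA
  have hcs2 := sq_comb_le W2 W1 W0 B hB
  have hcs3 := sq_comb_le W3 W2 W1 B hB
  rw [hu0] at hcs0
  rw [hu1] at hcs1
  rw [hv0] at hcs2
  rw [hv1] at hcs3
  have hBA : 0 ≤ (B - A) ^ 2 := sq_nonneg _
  have h4b : (B - A) ^ 2 * sb ^ 2 ≤ (B - A) ^ 2 * (2 * (s1 ^ 2 + s2 ^ 2)) :=
    mul_le_mul_of_nonneg_left hsb hBA
  have h4a : (B - A) ^ 2 * sa ^ 2 ≤ (B - A) ^ 2 * (2 * (t1 ^ 2 + t2 ^ 2)) :=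
    mul_le_mul_of_nonneg_left hsa hBA
  nlinarith [h4b, h4a, hcs0, hcs1, hcs2, hcs3]

/-- **Four consecutive differences `sin(mβ) − sin(mα)` cannot all be small**:
`∑_{j<4} (sin((y+j)β) − sin((y+j)α))² ≥ (cos β − cos α)²(sin²α + sin²β)/15`.
(The combination `w_{y+2} − 2cos α·w_{y+1} + w_y` kills the `α`-wave and equals
`2(cos β − cos α) sin((y+1)β)`; then two consecutive sines cannot both vanish.) [folklore] -/
theorem four_block (α β y : ℝ) :
    (Real.cos β - Real.cos α) ^ 2 * (Real.sin α ^ 2 + Real.sin β ^ 2) / 15 ≤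
      (Real.sin (y * β) - Real.sin (y * α)) ^ 2 +
        (Real.sin ((y + 1) * β) - Real.sin ((y + 1) * α)) ^ 2 +
        (Real.sin ((y + 2) * β) - Real.sin ((y + 2) * α)) ^ 2 +
        (Real.sin ((y + 3) * β) - Real.sin ((y + 3) * α)) ^ 2 := by
  -- the waves at `y`, `y+2`, `y+3` in terms of those at `y+1`, `y+2`
  have eb0 : Real.sin (y * β) =
      Real.sin ((y + 1) * β) * Real.cos β - Real.cos ((y + 1) * β) * Real.sin β := by
    rw [show y * β = (y + 1) * β - β by ring, Real.sin_sub]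
  have ea0 : Real.sin (y * α) =
      Real.sin ((y + 1) * α) * Real.cos α - Real.cos ((y + 1) * α) * Real.sin α := by
    rw [show y * α = (y + 1) * α - α by ring, Real.sin_sub]
  have eb2 : Real.sin ((y + 2) * β) =
      Real.sin ((y + 1) * β) * Real.cos β + Real.cos ((y + 1) * β) * Real.sin β := by
    rw [show (y + 2) * β = (y + 1) * β + β by ring, Real.sin_add]
  have ea2 : Real.sin ((y + 2) * α) =
      Real.sin ((y + 1) * α) * Real.cos α + Real.cos ((y + 1) * α) * Real.sin α := by
    rw [show (y + 2) * α = (y + 1) * α + α by ring, Real.sin_add]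
  have eb3 : Real.sin ((y + 3) * β) =
      Real.sin ((y + 2) * β) * Real.cos β + Real.cos ((y + 2) * β) * Real.sin β := by
    rw [show (y + 3) * β = (y + 2) * β + β by ring, Real.sin_add]
  have ea3 : Real.sin ((y + 3) * α) =
      Real.sin ((y + 2) * α) * Real.cos α + Real.cos ((y + 2) * α) * Real.sin α := by
    rw [show (y + 3) * α = (y + 2) * α + α by ring, Real.sin_add]
  have eb1 : Real.sin ((y + 1) * β) =
      Real.sin ((y + 2) * β) * Real.cos β - Real.cos ((y + 2) * β) * Real.sin β := by
    rw [show (y + 1) * β = (y + 2) * β - β by ring, Real.sin_sub]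
  have ea1 : Real.sin ((y + 1) * α) =
      Real.sin ((y + 2) * α) * Real.cos α - Real.cos ((y + 2) * α) * Real.sin α := by
    rw [show (y + 1) * α = (y + 2) * α - α by ring, Real.sin_sub]
  refine four_block_core (A := Real.cos α) (B := Real.cos β)
    (s1 := Real.sin ((y + 1) * β)) (s2 := Real.sin ((y + 2) * β))
    (t1 := Real.sin ((y + 1) * α)) (t2 := Real.sin ((y + 2) * α)) ?_ ?_ ?_ ?_ ?_ ?_
    (Real.cos_sq_le_one α) (Real.cos_sq_le_one β)
  · rw [eb0, ea0, eb2, ea2]; ring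
  · rw [eb3, ea3, eb1, ea1]; ring
  · rw [eb0, ea0, eb2, ea2]; ring
  · rw [eb3, ea3, eb1, ea1]; ring
  · have := sin_sq_le_two_mul ((y + 1) * β) β
    rwa [show (y + 1) * β + β = (y + 2) * β by ring] at this
  · have := sin_sq_le_two_mul ((y + 1) * α) α
    rwa [show (y + 1) * α + α = (y + 2) * α by ring] at this

/-- Summing over `range (4P)` in blocks of four. [folklore] -/
theorem sum_range_four_mul (f : ℕ → ℝ) (P : ℕ) :
    ∑ m ∈ range (4 * P), f m =
      ∑ p ∈ range P, (f (4 * p) + f (4 * p + 1) + f (4 * p + 2) + f (4 * p + 3)) := by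
  induction P with
  | zero => simp
  | succ P ih =>
      rw [show 4 * (P + 1) = 4 * P + 3 + 1 by ring, Finset.sum_range_succ,
        show 4 * P + 3 = 4 * P + 2 + 1 by ring, Finset.sum_range_succ,
        show 4 * P + 2 = 4 * P + 1 + 1 by ring, Finset.sum_range_succ, Finset.sum_range_succ, ih,
        Finset.sum_range_succ]
      ring

/-- The triangular re-summation `∑_{i<K} ∑_{j<K−i} g(i+j+1) = ∑_{m<K} (m+1) g(m+1)`. [folklore] -/
theorem sum_triangle (g : ℕ → ℝ) (K : ℕ) :
    ∑ i ∈ range K, ∑ j ∈ range (K - i), g (i + j + 1) =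
      ∑ m ∈ range K, ((m : ℝ) + 1) * g (m + 1) := by
  induction K with
  | zero => simp
  | succ K ih =>
      rw [Finset.sum_range_succ (fun m => ((m : ℝ) + 1) * g (m + 1)), ← ih, Finset.sum_range_succ,
        Nat.add_sub_cancel_left, Finset.sum_range_one, add_zero]
      have hinner : ∀ i ∈ range K, ∑ j ∈ range (K + 1 - i), g (i + j + 1) =
          ∑ j ∈ range (K - i), g (i + j + 1) + g (K + 1) := by
        intro i hi
        rw [Finset.mem_range] at hi
        rw [Nat.sub_add_comm hi.le, Finset.sum_range_succ, Nat.add_sub_cancel' hi.le]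
      rw [Finset.sum_congr rfl hinner, Finset.sum_add_distrib, Finset.sum_const, Finset.card_range,
        nsmul_eq_mul, Nat.add_zero]
      ring

/-- For `g ≥ 0`: `∑_{m<K} (m+1) g(m+1) ≤ ∑_{i<K} ∑_{j<K} g(i+j+1)`. [folklore] -/
theorem triangle_le (g : ℕ → ℝ) (hg : ∀ m, 0 ≤ g m) (K : ℕ) :
    ∑ m ∈ range K, ((m : ℝ) + 1) * g (m + 1) ≤ ∑ i ∈ range K, ∑ j ∈ range K, g (i + j + 1) := by
  rw [← sum_triangle]
  refine Finset.sum_le_sum fun i _ => ?_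
  exact Finset.sum_le_sum_of_subset_of_nonneg (Finset.range_mono (Nat.sub_le K i))
    fun j _ _ => hg _

/-- The geometric factor `κ(a, b) = (cos(πa/L) − cos(πb/L))² (sin²(πa/L) + sin²(πb/L))`; it
vanishes only on the diagonal `a = b` and at the two corners `{a, b} = {0, L}`. [folklore] -/
def dKappa (L a b : ℝ) : ℝ :=
  (Real.cos (π * a / L) - Real.cos (π * b / L)) ^ 2 *
    (Real.sin (π * a / L) ^ 2 + Real.sin (π * b / L) ^ 2)

/-- `κ ≥ 0`. [folklore] -/
theorem dKappa_nonneg (L a b : ℝ) : 0 ≤ dKappa L a b := by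
  unfold dKappa; positivity

/-- `κ` is symmetric. [folklore] -/
theorem dKappa_comm (L a b : ℝ) : dKappa L a b = dKappa L b a := by
  unfold dKappa; ring

/-- `κ(min, max) = κ(a, b)`. [folklore] -/
theorem dKappa_min_max (L a b : ℝ) : dKappa L (min a b) (max a b) = dKappa L a b := by
  rcases le_total a b with h | h
  · rw [min_eq_left h, max_eq_right h]
  · rw [min_eq_right h, max_eq_left h, dKappa_comm]

/-- The harmonic number `H_P = ∑_{j<P} 1/(j+1)`. [folklore] -/
def harm (P : ℕ) : ℝ := ∑ j ∈ range P, 1 / ((j : ℝ) + 1)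

/-- `H_P ≥ 0`. [folklore] -/
theorem harm_nonneg (P : ℕ) : 0 ≤ harm P :=
  Finset.sum_nonneg fun j _ => by positivity

/-- `H` is monotone. [folklore] -/
theorem harm_mono : Monotone harm := fun P P' h =>
  Finset.sum_le_sum_of_subset_of_nonneg (Finset.range_mono h) fun j _ _ => by positivity

/-- The weighted main term in blocks of four: `∑_{m<4P} (m+1) c(m+1)² ≥ κ H_P/(60π²)`. [folklore] -/
theorem sum_weighted_cD_ge (hL : 0 < L) (P : ℕ) :
    dKappa L a b / (60 * π ^ 2) * harm P ≤
      ∑ m ∈ range (4 * P), ((m : ℝ) + 1) * cD L a b ((m : ℤ) + 1) ^ 2 := by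
  set α := π * min a b / L with hα
  set β := π * max a b / L with hβ
  set f : ℕ → ℝ := fun m =>
    (Real.sin (((m : ℝ) + 1) * β) - Real.sin (((m : ℝ) + 1) * α)) ^ 2 / (((m : ℝ) + 1) * π ^ 2)
    with hf
  have hterm : ∀ m ∈ range (4 * P), ((m : ℝ) + 1) * cD L a b ((m : ℤ) + 1) ^ 2 = f m := by
    intro m _
    have hm : ((m : ℤ) + 1) ≠ 0 := by omega
    rw [cD_eq hL hm, hf]
    have e1 : (((m : ℤ) + 1 : ℤ) : ℝ) = (m : ℝ) + 1 := by push_cast; ring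
    simp only [e1]
    have e2 : ((m : ℝ) + 1) * π * max a b / L = ((m : ℝ) + 1) * β := by rw [hβ]; ring
    have e3 : ((m : ℝ) + 1) * π * min a b / L = ((m : ℝ) + 1) * α := by rw [hα]; ring
    rw [e2, e3]
    have hm1 : (0 : ℝ) < (m : ℝ) + 1 := by positivity
    field_simp
  rw [Finset.sum_congr rfl hterm, sum_range_four_mul]
  unfold harm
  rw [Finset.mul_sum]
  refine Finset.sum_le_sum fun p _ => ?_
  have hκ : dKappa L a b = (Real.cos β - Real.cos α) ^ 2 * (Real.sin α ^ 2 + Real.sin β ^ 2) := by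
    rw [← dKappa_min_max]
    unfold dKappa
    rw [hα, hβ]
    ring
  have c0 : ((4 * p : ℕ) : ℝ) + 1 = 4 * (p : ℝ) + 1 := by push_cast; ring
  have c1 : ((4 * p + 1 : ℕ) : ℝ) + 1 = 4 * (p : ℝ) + 2 := by push_cast; ring
  have c2 : ((4 * p + 2 : ℕ) : ℝ) + 1 = 4 * (p : ℝ) + 3 := by push_cast; ring
  have c3 : ((4 * p + 3 : ℕ) : ℝ) + 1 = 4 * (p : ℝ) + 4 := by push_cast; ring
  rw [c0, c1, c2, c3]
  have h4 := four_block α β (4 * (p : ℝ) + 1)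
  rw [show 4 * (p : ℝ) + 1 + 1 = 4 * (p : ℝ) + 2 by ring,
    show 4 * (p : ℝ) + 1 + 2 = 4 * (p : ℝ) + 3 by ring,
    show 4 * (p : ℝ) + 1 + 3 = 4 * (p : ℝ) + 4 by ring] at h4
  -- the four numerators
  set n0 := (Real.sin ((4 * (p : ℝ) + 1) * β) - Real.sin ((4 * (p : ℝ) + 1) * α)) ^ 2 with hn0
  set n1 := (Real.sin ((4 * (p : ℝ) + 2) * β) - Real.sin ((4 * (p : ℝ) + 2) * α)) ^ 2 with hn1
  set n2 := (Real.sin ((4 * (p : ℝ) + 3) * β) - Real.sin ((4 * (p : ℝ) + 3) * α)) ^ 2 with hn2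
  set n3 := (Real.sin ((4 * (p : ℝ) + 4) * β) - Real.sin ((4 * (p : ℝ) + 4) * α)) ^ 2 with hn3
  have hp0 : (0 : ℝ) ≤ p := Nat.cast_nonneg p
  have hπ : 0 < π ^ 2 := by positivity
  have hden : ∀ c : ℝ, 0 < c → c ≤ 4 * (p : ℝ) + 4 → ∀ x : ℝ, 0 ≤ x →
      x / ((4 * (p : ℝ) + 4) * π ^ 2) ≤ x / (c * π ^ 2) := by
    intro c hc hc4 x hx
    apply div_le_div_of_nonneg_left hx (by positivity)
    exact mul_le_mul_of_nonneg_right hc4 hπ.le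
  have hq0 := hden (4 * (p : ℝ) + 1) (by linarith) (by linarith) n0 (by positivity)
  have hq1 := hden (4 * (p : ℝ) + 2) (by linarith) (by linarith) n1 (by positivity)
  have hq2 := hden (4 * (p : ℝ) + 3) (by linarith) (by linarith) n2 (by positivity)
  have hq3 := hden (4 * (p : ℝ) + 4) (by linarith) (le_refl _) n3 (by positivity)
  have hsum : dKappa L a b / 15 / ((4 * (p : ℝ) + 4) * π ^ 2) ≤
      n0 / ((4 * (p : ℝ) + 4) * π ^ 2) + n1 / ((4 * (p : ℝ) + 4) * π ^ 2) +
        n2 / ((4 * (p : ℝ) + 4) * π ^ 2) + n3 / ((4 * (p : ℝ) + 4) * π ^ 2) := by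
    rw [← add_div, ← add_div, ← add_div]
    apply div_le_div_of_nonneg_right _ (by positivity)
    rw [hκ]
    linarith [h4]
  have hlhs : dKappa L a b / (60 * π ^ 2) * (1 / ((p : ℝ) + 1)) =
      dKappa L a b / 15 / ((4 * (p : ℝ) + 4) * π ^ 2) := by
    field_simp
    ring
  rw [hlhs]
  linarith [hsum, hq0, hq1, hq2, hq3]

/-- **Logarithmic growth of the number variance in the box**:
`V_N(a, b) ≥ κ(a, b) H_{⌊N/4⌋}/(120π²) − 4/π²`. [folklore] -/
theorem dNumVar_ge (hL : 0 < L) (ha : a ∈ Set.Icc 0 L) (hb : b ∈ Set.Icc 0 L) (N : ℕ) :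
    dKappa L a b / (120 * π ^ 2) * harm (N / 4) - 4 / π ^ 2 ≤ dNumVar N L a b := by
  set P := N / 4 with hP
  set K := 4 * P with hKdef
  have hK : K ≤ N := Nat.mul_div_le N 4
  refine le_trans ?_ (block_le_dNumVar hL ha hb hK)
  -- termwise lower bound on the block
  have hblock : ∀ i ∈ range K, ∀ j ∈ range K,
      cD L a b ((i : ℤ) + j + 1) ^ 2 / 2 - 4 / (π ^ 2 * ((N : ℝ) + 1) ^ 2) ≤
        qD L a b (N - 1 - i) (N + j) ^ 2 := by
    intro i hi j hj
    rw [Finset.mem_range] at hi hj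
    rw [qD_block_eq hL j (by omega : i < N)]
    set X := cD L a b ((i : ℤ) + j + 1)
    set Y := cD L a b (2 * (N : ℤ) + 1 + j - i)
    have hY : Y ^ 2 ≤ 4 / (π ^ 2 * ((N : ℝ) + 1) ^ 2) := by
      have hm : (2 * (N : ℤ) + 1 + j - i) ≠ 0 := by omega
      have h1 : |Y| ≤ 2 / (|((2 * (N : ℤ) + 1 + j - i : ℤ) : ℝ)| * π) := abs_cD_le hL hm
      have h2 : ((N : ℝ) + 1) ≤ |((2 * (N : ℤ) + 1 + j - i : ℤ) : ℝ)| := by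
        have h3 : ((N : ℤ) + 1 : ℤ) ≤ 2 * (N : ℤ) + 1 + j - i := by omega
        have h4 : ((N : ℝ) + 1) ≤ ((2 * (N : ℤ) + 1 + j - i : ℤ) : ℝ) := by exact_mod_cast h3
        exact h4.trans (le_abs_self _)
      have hN1 : (0 : ℝ) < (N : ℝ) + 1 := by positivity
      have h3 : |Y| ≤ 2 / (((N : ℝ) + 1) * π) := by
        refine h1.trans ?_
        apply div_le_div_of_nonneg_left (by norm_num) (by positivity)
        exact mul_le_mul_of_nonneg_right h2 Real.pi_pos.le
      calc Y ^ 2 = |Y| ^ 2 := (sq_abs Y).symm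
        _ ≤ (2 / (((N : ℝ) + 1) * π)) ^ 2 := pow_le_pow_left₀ (abs_nonneg Y) h3 2
        _ = 4 / (π ^ 2 * ((N : ℝ) + 1) ^ 2) := by
            field_simp
            ring
    nlinarith [sq_nonneg (X - 2 * Y), hY]
  have hsum1 := Finset.sum_le_sum fun i hi => Finset.sum_le_sum fun j hj => hblock i hi j hj
  -- the error sum
  have herr : ∑ _i ∈ range K, ∑ _j ∈ range K, (4 / (π ^ 2 * ((N : ℝ) + 1) ^ 2)) ≤ 4 / π ^ 2 := by
    rw [Finset.sum_const, Finset.card_range, nsmul_eq_mul, Finset.sum_const, Finset.card_range,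
      nsmul_eq_mul]
    have hKle : (K : ℝ) ≤ N + 1 := by exact_mod_cast (by omega : K ≤ N + 1)
    have hK0 : (0 : ℝ) ≤ K := Nat.cast_nonneg K
    have hN1 : (0 : ℝ) < (N : ℝ) + 1 := by positivity
    have hratio : (K : ℝ) * K / ((N : ℝ) + 1) ^ 2 ≤ 1 := by
      rw [div_le_one (by positivity)]
      nlinarith
    have hπ : 0 < π ^ 2 := by positivity
    calc (K : ℝ) * ((K : ℝ) * (4 / (π ^ 2 * ((N : ℝ) + 1) ^ 2)))
        = 4 / π ^ 2 * ((K : ℝ) * K / ((N : ℝ) + 1) ^ 2) := by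
          field_simp
      _ ≤ 4 / π ^ 2 * 1 := mul_le_mul_of_nonneg_left hratio (by positivity)
      _ = 4 / π ^ 2 := mul_one _
  -- the main term
  have hmain := triangle_le (fun m => cD L a b (m : ℤ) ^ 2) (fun m => sq_nonneg _) K
  have hmain' : ∑ m ∈ range K, ((m : ℝ) + 1) * cD L a b ((m : ℤ) + 1) ^ 2 ≤
      ∑ i ∈ range K, ∑ j ∈ range K, cD L a b ((i : ℤ) + j + 1) ^ 2 := by
    convert hmain using 2
    · push_cast; ring_nf
    · push_cast; ring_nf
  have hw := sum_weighted_cD_ge hL P (a := a) (b := b)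
  rw [← hKdef] at hw
  -- assemble
  have hsplit : ∑ i ∈ range K, ∑ j ∈ range K,
      (cD L a b ((i : ℤ) + j + 1) ^ 2 / 2 - 4 / (π ^ 2 * ((N : ℝ) + 1) ^ 2)) =
      (∑ i ∈ range K, ∑ j ∈ range K, cD L a b ((i : ℤ) + j + 1) ^ 2) / 2 -
        ∑ _i ∈ range K, ∑ _j ∈ range K, (4 / (π ^ 2 * ((N : ℝ) + 1) ^ 2)) := by
    rw [Finset.sum_div, ← Finset.sum_sub_distrib]
    refine Finset.sum_congr rfl fun i _ => ?_
    rw [Finset.sum_div, ← Finset.sum_sub_distrib]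
  rw [hsplit] at hsum1
  have hfinal : dKappa L a b / (120 * π ^ 2) * harm P =
      (dKappa L a b / (60 * π ^ 2) * harm P) / 2 := by ring
  rw [hfinal]
  linarith [hsum1, herr, hmain', hw]

end Variance

/-! ### Part H: the majorant, uniform decay of its rows (Dini), and the mode bound -/

section Assembly

variable {n N : ℕ} {L a b x y : ℝ}

/-- The box state is non-negative. [folklore] -/
theorem dirichletState_nonneg (N : ℕ) (L : ℝ) (x : Fin N → ℝ) : 0 ≤ dirichletState N L x :=
  mul_nonneg (inv_nonneg.mpr (Real.sqrt_nonneg _)) (abs_nonneg _)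

/-- The one-body density matrix of the (non-negative) box state has non-negative kernel.
[folklore] -/
theorem dirichletDensityMatrix_nonneg (N : ℕ) (L x y : ℝ) : 0 ≤ dirichletDensityMatrix N L x y := by
  cases N with
  | zero => simp [dirichletDensityMatrix]
  | succ n =>
      show (0 : ℝ) ≤ (n + 1 : ℝ) * ∫ X in Set.pi Set.univ (fun _ : Fin n => Set.Icc (0 : ℝ) L),
        dirichletState (n + 1) L (Fin.cons x X) * dirichletState (n + 1) L (Fin.cons y X)
      refine mul_nonneg (by positivity) (integral_nonneg fun X => ?_)
      exact mul_nonneg (dirichletState_nonneg _ _ _) (dirichletState_nonneg _ _ _)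

/-- The explicit majorant `g^D_N(x, y) = exp(−κ(x, y) H_{⌊N/4⌋}/(60π²))`. [folklore] -/
def dMajorant (L : ℝ) (N : ℕ) (x y : ℝ) : ℝ :=
  Real.exp (-(dKappa L x y / (60 * π ^ 2) * harm (N / 4)))

/-- The majorant is non-negative. [folklore] -/
theorem dMajorant_nonneg : 0 ≤ dMajorant L N x y := (Real.exp_pos _).le

/-- The majorant is at most `1`. [folklore] -/
theorem dMajorant_le_one : dMajorant L N x y ≤ 1 := by
  unfold dMajorant
  rw [Real.exp_le_one_iff, neg_nonpos]
  exact mul_nonneg (div_nonneg (dKappa_nonneg _ _ _) (by positivity)) (harm_nonneg _)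

/-- The majorant is jointly continuous. [folklore] -/
theorem continuous_dMajorant (L : ℝ) (N : ℕ) : Continuous (Function.uncurry (dMajorant L N)) := by
  unfold dMajorant dKappa Function.uncurry
  fun_prop

/-- The majorant is non-increasing in `N`. [folklore] -/
theorem dMajorant_antitone (L x y : ℝ) : Antitone fun N => dMajorant L N x y := by
  intro N N' h
  unfold dMajorant
  apply Real.exp_le_exp.mpr
  apply neg_le_neg
  exact mul_le_mul_of_nonneg_left (harm_mono (Nat.div_le_div_right h))
    (div_nonneg (dKappa_nonneg _ _ _) (by positivity))

/-- **The pointwise bound** `ρ^D_N(a, b) ≤ (2N/L) e^{3/2} g^D_N(a, b)` on `[0, L]²`. [folklore] -/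
theorem dirichletDensity_le_majorant (hL : 0 < L) (ha : a ∈ Set.Icc 0 L) (hb : b ∈ Set.Icc 0 L) :
    dirichletDensityMatrix (n + 1) L a b ≤
      2 * (n + 1 : ℝ) / L * Real.exp (3 / 2) * dMajorant L (n + 1) a b := by
  refine (dirichletDensity_le_exp_numVar hL ha hb).trans ?_
  have hV := dNumVar_ge hL ha hb (n + 1)
  have hπ8 : 4 / π ^ 2 ≤ 1 / 2 := by
    rw [div_le_div_iff₀ (by positivity) (by norm_num)]
    nlinarith [Real.pi_gt_three]
  have h2 : dKappa L a b / (120 * π ^ 2) * harm ((n + 1) / 4) =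
      (dKappa L a b / (60 * π ^ 2) * harm ((n + 1) / 4)) / 2 := by ring
  rw [h2] at hV
  have key : Real.exp (1 / 2) * Real.exp (-2 * dNumVar (n + 1) L a b) ≤
      Real.exp (3 / 2) * dMajorant L (n + 1) a b := by
    unfold dMajorant
    rw [← Real.exp_add, ← Real.exp_add]
    apply Real.exp_le_exp.mpr
    linarith [hV, hπ8]
  calc 2 * (n + 1 : ℝ) / L * Real.exp (1 / 2) * Real.exp (-2 * dNumVar (n + 1) L a b)
      = 2 * (n + 1 : ℝ) / L * (Real.exp (1 / 2) * Real.exp (-2 * dNumVar (n + 1) L a b)) := by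
        ring
    _ ≤ 2 * (n + 1 : ℝ) / L * (Real.exp (3 / 2) * dMajorant L (n + 1) a b) :=
        mul_le_mul_of_nonneg_left key (by positivity)
    _ = 2 * (n + 1 : ℝ) / L * Real.exp (3 / 2) * dMajorant L (n + 1) a b := by ring

/-- The row integrals `G_N(x) = ∫₀ᴸ g^D_N(x, y) dy` of the majorant. [folklore] -/
def dRow (L : ℝ) (N : ℕ) (x : ℝ) : ℝ := ∫ y in Set.Icc 0 L, dMajorant L N x y

/-- `G_N ≥ 0`. [folklore] -/
theorem dRow_nonneg : 0 ≤ dRow L N x := integral_nonneg fun _ => dMajorant_nonneg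

/-- `G_N` is continuous. [folklore] -/
theorem continuous_dRow (L : ℝ) (N : ℕ) : Continuous (dRow L N) := by
  have h : Continuous fun x => ∫ y in Set.Icc 0 L, dMajorant L N x y :=
    continuous_parametric_integral_of_continuous (continuous_dMajorant L N) isCompact_Icc
  exact h

/-- The majorant is continuous in its second variable. [folklore] -/
theorem continuous_dMajorant_right (L : ℝ) (N : ℕ) (x : ℝ) :
    Continuous fun y => dMajorant L N x y := by
  unfold dMajorant dKappa
  fun_prop

/-- `G_N(x)` is non-increasing in `N`. [folklore] -/
theorem dRow_antitone (L x : ℝ) : Antitone fun N => dRow L N x := by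
  intro N N' h
  unfold dRow
  exact integral_mono_of_nonneg (Filter.Eventually.of_forall fun y => dMajorant_nonneg)
    (continuous_dMajorant_right L N x).integrableOn_Icc
    (Filter.Eventually.of_forall fun y => dMajorant_antitone L x y h)

/-- For fixed `x`, the zero set of `κ(x, ·)` is countable (the diagonal point and lattice points).
[folklore] -/
theorem countable_dKappa_eq_zero (hL : 0 < L) (x : ℝ) : ({y : ℝ | dKappa L x y = 0}).Countable := by
  have hπ := Real.pi_pos
  have hsub : {y : ℝ | dKappa L x y = 0} ⊆
      ((Set.range fun k : ℤ => (2 * k * π + π * x / L) * L / π) ∪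
        (Set.range fun k : ℤ => (2 * k * π - π * x / L) * L / π)) ∪
        (Set.range fun k : ℤ => k * L) := by
    intro y hy
    rw [Set.mem_setOf_eq, dKappa, mul_eq_zero] at hy
    have hy' : y = (π * y / L) * L / π := by field_simp
    rcases hy with h | h
    · have hc : Real.cos (π * x / L) = Real.cos (π * y / L) := by
        have h0 := (pow_eq_zero_iff (n := 2) (by norm_num)).mp h
        linarith
      obtain ⟨k, hk | hk⟩ := Real.cos_eq_cos_iff.mp hc
      · left; left
        refine ⟨k, ?_⟩
        dsimp only
        rw [← hk]
        exact hy'.symm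
      · left; right
        refine ⟨k, ?_⟩
        dsimp only
        rw [← hk]
        exact hy'.symm
    · have hs : Real.sin (π * y / L) = 0 := by
        have h1 : Real.sin (π * y / L) ^ 2 = 0 := by
          nlinarith [sq_nonneg (Real.sin (π * x / L)), sq_nonneg (Real.sin (π * y / L))]
        exact (pow_eq_zero_iff (n := 2) (by norm_num)).mp h1
      obtain ⟨m, hm⟩ := Real.sin_eq_zero_iff.mp hs
      right
      refine ⟨m, ?_⟩
      have h2 : π * ((m : ℝ) * L) = π * y := by
        have h3 : (m : ℝ) * π * L = π * y := by
          rw [hm]; field_simp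
        linarith [h3, show π * ((m : ℝ) * L) = (m : ℝ) * π * L by ring]
      exact mul_left_cancel₀ hπ.ne' h2
  exact (((Set.countable_range _).union (Set.countable_range _)).union
    (Set.countable_range _)).mono hsub

/-- The row integrals tend to zero for every `x` (dominated convergence). [folklore] -/
theorem tendsto_dRow (hL : 0 < L) (x : ℝ) : Tendsto (fun N => dRow L N x) atTop (𝓝 0) := by
  have hbad := countable_dKappa_eq_zero hL x
  have hharm : Tendsto (fun N : ℕ => harm (N / 4)) atTop atTop := by
    have h1 : Tendsto (fun N : ℕ => N / 4) atTop atTop := by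
      refine tendsto_atTop_atTop.2 fun b => ⟨4 * b, fun N hN => ?_⟩
      exact (Nat.le_div_iff_mul_le (by norm_num)).2 (by omega)
    unfold harm
    exact Real.tendsto_sum_range_one_div_nat_succ_atTop.comp h1
  have hae : ∀ᵐ y ∂(volume.restrict (Set.Icc (0 : ℝ) L)),
      Tendsto (fun N => dMajorant L N x y) atTop (𝓝 0) := by
    have h0 : (volume.restrict (Set.Icc (0 : ℝ) L)) {y : ℝ | dKappa L x y = 0} = 0 :=
      hbad.measure_zero _
    filter_upwards [compl_mem_ae_iff.mpr h0] with y hy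
    simp only [Set.mem_compl_iff, Set.mem_setOf_eq] at hy
    have hpos : 0 < dKappa L x y := lt_of_le_of_ne (dKappa_nonneg _ _ _) (Ne.symm hy)
    have hc : 0 < dKappa L x y / (60 * π ^ 2) := by positivity
    unfold dMajorant
    have h1 : Tendsto (fun N : ℕ => dKappa L x y / (60 * π ^ 2) * harm (N / 4)) atTop atTop :=
      Tendsto.const_mul_atTop hc hharm
    exact Real.tendsto_exp_comp_nhds_zero.mpr (tendsto_neg_atTop_atBot.comp h1)
  have h := tendsto_integral_of_dominated_convergence (μ := volume.restrict (Set.Icc (0 : ℝ) L))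
    (F := fun N y => dMajorant L N x y) (f := fun _ => 0) (fun _ => 1)
    (fun N => (continuous_dMajorant_right L N x).aestronglyMeasurable)
    (integrable_const _)
    (fun N => Filter.Eventually.of_forall fun y => by
      rw [Real.norm_eq_abs, abs_of_nonneg dMajorant_nonneg]
      exact dMajorant_le_one)
    hae
  simpa [dRow] using h

/-- **Uniform decay of the rows** (Dini's theorem: the rows are continuous in `x`, non-increasing
in `N`, and tend to `0` pointwise on the compact `[0, L]`). [folklore] -/
theorem tendstoUniformlyOn_dRow (hL : 0 < L) :
    TendstoUniformlyOn (fun N x => dRow L N x) (fun _ => 0) atTop (Set.Icc 0 L) :=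
  Antitone.tendstoUniformlyOn_of_forall_tendsto isCompact_Icc
    (fun N => (continuous_dRow L N).continuousOn) (fun x _ => dRow_antitone L x)
    continuousOn_const (fun x _ => tendsto_dRow hL x)

/-- `sup_{x ∈ [0,L]} G_N(x) ≤ δ` eventually, for every `δ > 0`. [folklore] -/
theorem eventually_dRow_le (hL : 0 < L) {δ : ℝ} (hδ : 0 < δ) :
    ∀ᶠ N : ℕ in atTop, ∀ x ∈ Set.Icc 0 L, dRow L N x ≤ δ := by
  have h := Metric.tendstoUniformlyOn_iff.mp (tendstoUniformlyOn_dRow hL) δ hδ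
  filter_upwards [h] with N hN x hx
  have h1 := hN x hx
  rw [Real.dist_eq, zero_sub, abs_neg, abs_of_nonneg dRow_nonneg] at h1
  exact h1.le

/-- The quadratic form `⟨φ, γ^D_N φ⟩ = ∫₀ᴸ∫₀ᴸ conj φ(x) ρ^D_N(x, y) φ(y) dy dx` of the one-body
density matrix of the box state in the mode `φ`. [cite: ForresterFrankelGaroni2003, §4.1] -/
def dirichletForm (N : ℕ) (L : ℝ) (φ : ℝ → ℂ) : ℂ :=
  ∫ x in Set.Icc 0 L, ∫ y in Set.Icc 0 L, conj (φ x) * (dirichletDensityMatrix N L x y : ℂ) * φ y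

/-- Pointwise bound on the integrand of `⟨φ, γ^D_N φ⟩` (majorant bound, `0 ≤ g ≤ 1`, weighted
AM–GM). [folklore] -/
theorem norm_dirichletIntegrand_le (hL : 0 < L) (n : ℕ) {t : ℝ} (ht : 0 < t) (φ : ℝ → ℂ)
    {x y : ℝ} (hx : x ∈ Set.Icc 0 L) (hy : y ∈ Set.Icc 0 L) :
    ‖conj (φ x) * (dirichletDensityMatrix (n + 1) L x y : ℂ) * φ y‖ ≤
      2 * (n + 1 : ℝ) / L * Real.exp (3 / 2) *
        (dMajorant L (n + 1) x y * ‖φ x‖ ^ 2 / (2 * t) + t * ‖φ y‖ ^ 2 / 2) := by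
  set K : ℝ := 2 * (n + 1 : ℝ) / L * Real.exp (3 / 2) with hK
  rw [norm_mul, norm_mul, Complex.norm_conj, Complex.norm_real, Real.norm_eq_abs,
    abs_of_nonneg (dirichletDensityMatrix_nonneg _ _ _ _)]
  have hγ := dirichletDensity_le_majorant (n := n) hL hx hy
  have hg1 : dMajorant L (n + 1) x y ≤ 1 := dMajorant_le_one
  have hg0 : 0 ≤ dMajorant L (n + 1) x y := dMajorant_nonneg
  have ha := norm_nonneg (φ x)
  have hb := norm_nonneg (φ y)
  have hab := mul_le_sq_div_add_sq ‖φ x‖ ‖φ y‖ ht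
  have htb : 0 ≤ t * ‖φ y‖ ^ 2 / 2 := by positivity
  have hK0 : 0 ≤ K := by positivity
  calc ‖φ x‖ * dirichletDensityMatrix (n + 1) L x y * ‖φ y‖
      ≤ ‖φ x‖ * (K * dMajorant L (n + 1) x y) * ‖φ y‖ := by gcongr
    _ = K * (dMajorant L (n + 1) x y * (‖φ x‖ * ‖φ y‖)) := by ring
    _ ≤ K * (dMajorant L (n + 1) x y * (‖φ x‖ ^ 2 / (2 * t) + t * ‖φ y‖ ^ 2 / 2)) := by gcongr
    _ = K * (dMajorant L (n + 1) x y * ‖φ x‖ ^ 2 / (2 * t) +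
          dMajorant L (n + 1) x y * (t * ‖φ y‖ ^ 2 / 2)) := by ring
    _ ≤ K * (dMajorant L (n + 1) x y * ‖φ x‖ ^ 2 / (2 * t) + 1 * (t * ‖φ y‖ ^ 2 / 2)) := by
        gcongr
    _ = K * (dMajorant L (n + 1) x y * ‖φ x‖ ^ 2 / (2 * t) + t * ‖φ y‖ ^ 2 / 2) := by ring

/-- **Uniform quadratic-form bound.** If every row integral of the majorant is at most `S` on
`[0, L]`, then for every `t > 0` and every `φ` with `|φ|²` integrable,
`|⟨φ, γ^D_N φ⟩| ≤ (2N/L) e^{3/2} (S/(2t) + tL/2) ‖φ‖²`. No Fubini is needed. [folklore] -/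
theorem norm_dirichletForm_le (hL : 0 < L) (n : ℕ) {t : ℝ} (ht : 0 < t) (φ : ℝ → ℂ)
    (hφ : IntegrableOn (fun x => ‖φ x‖ ^ 2) (Set.Icc 0 L)) {S : ℝ}
    (hS : ∀ x ∈ Set.Icc 0 L, dRow L (n + 1) x ≤ S) :
    ‖dirichletForm (n + 1) L φ‖ ≤
      2 * (n + 1 : ℝ) / L * Real.exp (3 / 2) * (S / (2 * t) + t * L / 2) * modeNormSq L φ := by
  set K : ℝ := 2 * (n + 1 : ℝ) / L * Real.exp (3 / 2) with hK
  have hK0 : 0 ≤ K := by positivity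
  have hA := modeNormSq_nonneg L φ
  -- inner bound, for `x ∈ [0, L]`
  have hinner : ∀ x ∈ Set.Icc (0 : ℝ) L,
      ‖∫ y in Set.Icc 0 L, conj (φ x) * (dirichletDensityMatrix (n + 1) L x y : ℂ) * φ y‖ ≤
        K * (‖φ x‖ ^ 2 * S / (2 * t) + t * modeNormSq L φ / 2) := by
    intro x hx
    have hint1 : IntegrableOn (fun y => dMajorant L (n + 1) x y * ‖φ x‖ ^ 2 / (2 * t))
        (Set.Icc 0 L) :=
      (((continuous_dMajorant_right L (n + 1) x).mul continuous_const).div_const _).integrableOn_Icc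
    have hint2 : IntegrableOn (fun y => t * ‖φ y‖ ^ 2 / 2) (Set.Icc 0 L) := by
      have : (fun y => t * ‖φ y‖ ^ 2 / 2) = fun y => t / 2 * ‖φ y‖ ^ 2 := by
        ext y; ring
      rw [this]
      exact hφ.const_mul _
    have hint : IntegrableOn (fun y => K *
        (dMajorant L (n + 1) x y * ‖φ x‖ ^ 2 / (2 * t) + t * ‖φ y‖ ^ 2 / 2)) (Set.Icc 0 L) :=
      (hint1.add hint2).const_mul _
    have hrow : (∫ y in Set.Icc 0 L, dMajorant L (n + 1) x y) ≤ S := hS x hx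
    calc ‖∫ y in Set.Icc 0 L, conj (φ x) * (dirichletDensityMatrix (n + 1) L x y : ℂ) * φ y‖
        ≤ ∫ y in Set.Icc 0 L, ‖conj (φ x) * (dirichletDensityMatrix (n + 1) L x y : ℂ) * φ y‖ :=
          norm_integral_le_integral_norm _
      _ ≤ ∫ y in Set.Icc 0 L, K *
            (dMajorant L (n + 1) x y * ‖φ x‖ ^ 2 / (2 * t) + t * ‖φ y‖ ^ 2 / 2) := by
          refine integral_mono_of_nonneg (Filter.Eventually.of_forall fun y => norm_nonneg _) hint ?_
          exact ae_restrict_of_forall_mem measurableSet_Icc fun y hy =>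
            norm_dirichletIntegrand_le hL n ht φ hx hy
      _ = K * ((∫ y in Set.Icc 0 L, dMajorant L (n + 1) x y) * ‖φ x‖ ^ 2 / (2 * t) +
              t * modeNormSq L φ / 2) := by
          rw [integral_const_mul, integral_add hint1 hint2]
          congr 2
          · rw [integral_div, integral_mul_const]
          · rw [modeNormSq, integral_div, integral_const_mul]
      _ ≤ K * (‖φ x‖ ^ 2 * S / (2 * t) + t * modeNormSq L φ / 2) := by
          apply mul_le_mul_of_nonneg_left _ hK0
          have h1 : (∫ y in Set.Icc 0 L, dMajorant L (n + 1) x y) * ‖φ x‖ ^ 2 ≤ S * ‖φ x‖ ^ 2 :=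
            mul_le_mul_of_nonneg_right hrow (sq_nonneg _)
          have h2 : (∫ y in Set.Icc 0 L, dMajorant L (n + 1) x y) * ‖φ x‖ ^ 2 / (2 * t) ≤
              ‖φ x‖ ^ 2 * S / (2 * t) := by
            rw [mul_comm (‖φ x‖ ^ 2) S]
            exact div_le_div_of_nonneg_right h1 (by positivity)
          linarith
  -- outer bound
  have hout1 : IntegrableOn (fun x => ‖φ x‖ ^ 2 * S / (2 * t)) (Set.Icc 0 L) := by
    have : (fun x => ‖φ x‖ ^ 2 * S / (2 * t)) = fun x => S / (2 * t) * ‖φ x‖ ^ 2 := by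
      ext x; ring
    rw [this]
    exact hφ.const_mul _
  have hout2 : IntegrableOn (fun _ : ℝ => t * modeNormSq L φ / 2) (Set.Icc 0 L) :=
    continuous_const.integrableOn_Icc
  have hout : IntegrableOn (fun x => K * (‖φ x‖ ^ 2 * S / (2 * t) + t * modeNormSq L φ / 2))
      (Set.Icc 0 L) :=
    (hout1.add hout2).const_mul _
  calc ‖dirichletForm (n + 1) L φ‖
      ≤ ∫ x in Set.Icc 0 L, ‖∫ y in Set.Icc 0 L,
          conj (φ x) * (dirichletDensityMatrix (n + 1) L x y : ℂ) * φ y‖ :=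
        norm_integral_le_integral_norm _
    _ ≤ ∫ x in Set.Icc 0 L, K * (‖φ x‖ ^ 2 * S / (2 * t) + t * modeNormSq L φ / 2) :=
        integral_mono_of_nonneg (Filter.Eventually.of_forall fun x => norm_nonneg _) hout
          (ae_restrict_of_forall_mem measurableSet_Icc hinner)
    _ = K * (modeNormSq L φ * S / (2 * t) + L * (t * modeNormSq L φ / 2)) := by
        rw [integral_const_mul, integral_add hout1 hout2, setIntegral_Icc_const hL.le]
        congr 2
        rw [integral_div, integral_mul_const, modeNormSq]
    _ = K * (S / (2 * t) + t * L / 2) * modeNormSq L φ := by ring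

/-- **Uniform `ε`-form of the bound**: for every `ε > 0`, for all large `N`, every mode `φ` with
`|φ|²` integrable on `[0, L]` has `|⟨φ, γ^D_N φ⟩| ≤ ε N ‖φ‖²` (choose `t = ε e^{-3/2}/2` and use the
uniform decay of the rows). [folklore] -/
theorem eventually_norm_dirichletForm_le (hL : 0 < L) {ε : ℝ} (hε : 0 < ε) :
    ∀ᶠ N : ℕ in atTop, ∀ φ : ℝ → ℂ, IntegrableOn (fun x => ‖φ x‖ ^ 2) (Set.Icc 0 L) →
      ‖dirichletForm N L φ‖ ≤ ε * N * modeNormSq L φ := by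
  set E : ℝ := Real.exp (3 / 2) with hE
  have hE0 : 0 < E := Real.exp_pos _
  set t : ℝ := ε / (2 * E) with htdef
  have ht : 0 < t := by positivity
  set δ : ℝ := L * ε ^ 2 / (4 * E ^ 2) with hδdef
  have hδ : 0 < δ := by positivity
  filter_upwards [eventually_dRow_le hL hδ, eventually_ge_atTop 1] with N hN hN1 φ hφ
  obtain ⟨n, rfl⟩ := Nat.exists_eq_succ_of_ne_zero (Nat.one_le_iff_ne_zero.mp hN1)
  have hb := norm_dirichletForm_le hL n ht φ hφ hN
  have hA := modeNormSq_nonneg L φ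
  have hkey : 2 / L * E * (δ / (2 * t) + t * L / 2) = ε := by
    rw [hδdef, htdef]
    field_simp
    ring
  calc ‖dirichletForm (n + 1) L φ‖
      ≤ 2 * (n + 1 : ℝ) / L * E * (δ / (2 * t) + t * L / 2) * modeNormSq L φ := hb
    _ = (2 / L * E * (δ / (2 * t) + t * L / 2)) * (n + 1 : ℝ) * modeNormSq L φ := by ring
    _ = ε * ((n + 1 : ℕ) : ℝ) * modeNormSq L φ := by rw [hkey]; push_cast; ring

end Assembly

/-! ### Non-vacuity: the typed density matrix is the genuine one (`tr γ^D_N = N`) -/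

section Trace

variable {n : ℕ} {L a : ℝ}

/-- On the diagonal the arc is empty: `Q(a, a) = 0`. [folklore] -/
theorem qD_self (L a : ℝ) (k l : ℕ) : qD L a a k l = 0 := by
  unfold qD
  rw [min_self, max_self, Set.Ioo_self, Measure.restrict_empty, integral_zero_measure, mul_zero]

/-- On the diagonal Lenard's Dirichlet matrix is the identity. [folklore] -/
theorem dirichletMatrix_self (n : ℕ) (L a : ℝ) : dirichletMatrix n L a a = 1 := by
  ext k l
  simp only [dirichletMatrix, of_apply, qD_self, mul_zero, sub_zero, Matrix.one_apply]

/-- **Diagonal of the density matrix**: `ρ^D_{n+1}(a, a) = (2/L) ∑_{t ≤ n} sin²((t+1)πa/L)` for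
`a ∈ [0, L]` (the free-fermion density, as it must be). [cite: ForresterFrankelGaroni2003, §3] -/
theorem dirichletDensity_self (hL : 0 < L) (ha : a ∈ Set.Icc 0 L) :
    dirichletDensityMatrix (n + 1) L a a = 2 / L * ∑ t : Fin (n + 1), dOrb L t a ^ 2 := by
  rw [dirichletDensity_eq_adjugate hL ha ha, dirichletMatrix_self, adjugate_one, one_mulVec]
  congr 1
  simp only [dotProduct, fVec, sq]

/-- **Trace normalisation** `∫₀ᴸ ρ^D_N(x, x) dx = N`: the typed kernel carries all `N` particles, so
the `o(N)` mode bound is not an artefact of a mis-normalised object. [folklore] -/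
theorem integral_dirichletDensity_diag (hL : 0 < L) (N : ℕ) :
    ∫ x in Set.Icc 0 L, dirichletDensityMatrix N L x x = N := by
  cases N with
  | zero => simp [dirichletDensityMatrix]
  | succ n =>
      have h : ∀ x ∈ Set.Icc (0 : ℝ) L, dirichletDensityMatrix (n + 1) L x x =
          2 / L * ∑ t : Fin (n + 1), dOrb L t x ^ 2 := fun x hx => dirichletDensity_self hL hx
      rw [setIntegral_congr_fun measurableSet_Icc h, integral_const_mul,
        integral_finsetSum _ (f := fun (t : Fin (n + 1)) (x : ℝ) => dOrb L t x ^ 2)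
          fun t _ => (by unfold dOrb; fun_prop : Continuous fun x : ℝ => dOrb L t x ^ 2).integrableOn_Icc]
      have ht : ∀ t : Fin (n + 1), ∫ x in Set.Icc 0 L, dOrb L t x ^ 2 = L / 2 := by
        intro t
        have := integral_dOrb_mul_dOrb hL (t : ℕ) (t : ℕ)
        rw [if_pos rfl] at this
        rw [← this]
        refine setIntegral_congr_fun measurableSet_Icc fun x _ => ?_
        ring
      simp_rw [ht]
      rw [Finset.sum_const, Finset.card_univ, Fintype.card_fin, nsmul_eq_mul]
      push_cast
      field_simp

end Trace

/-! ### Scale invariance: the box gas has no length scale (thermodynamic-limit form) -/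

section Scaling

variable {n : ℕ} {L : ℝ}

open scoped Pointwise

/-- The Slater matrix is scale-free: `M_L(L x) = M_1(x)`. [folklore] -/
theorem dSlater_smul (N : ℕ) (hL : 0 < L) (x : Fin N → ℝ) :
    dSlater N L (L • x) = dSlater N 1 x := by
  ext r t
  simp only [dSlater, of_apply, dOrb, Pi.smul_apply, smul_eq_mul]
  congr 1
  field_simp

/-- Scaling of the box state: `Ψ_{N,L}(L x) = L^{-N/2} Ψ_{N,1}(x)`. [folklore] -/
theorem dirichletState_smul (N : ℕ) (hL : 0 < L) (x : Fin N → ℝ) :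
    dirichletState N L (L • x) = (Real.sqrt (L ^ N))⁻¹ * dirichletState N 1 x := by
  unfold dirichletState
  rw [dSlater_smul N hL, show (L / 2) ^ N = L ^ N * (1 / 2) ^ N by rw [← mul_pow]; ring_nf,
    show (N.factorial : ℝ) * (L ^ N * (1 / 2) ^ N) = L ^ N * ((N.factorial : ℝ) * (1 / 2) ^ N) by
      ring, Real.sqrt_mul (pow_nonneg hL.le _), mul_inv]
  ring

/-- `cons` commutes with scaling. [folklore] -/
theorem cons_smul (L : ℝ) (X : Fin n → ℝ) (x : ℝ) :
    (Fin.cons (L * x) (L • X) : Fin (n + 1) → ℝ) = L • (Fin.cons x X : Fin (n + 1) → ℝ) := by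
  ext i
  refine Fin.cases ?_ (fun j => ?_) i
  · simp
  · simp

/-- **Scale covariance of the one-body density matrix in the box**:
`ρ^D_{N,L}(Lx, Ly) = L⁻¹ ρ^D_{N,1}(x, y)`. [folklore] -/
theorem dirichletDensityMatrix_smul (N : ℕ) (hL : 0 < L) (x y : ℝ) :
    dirichletDensityMatrix N L (L * x) (L * y) = L⁻¹ * dirichletDensityMatrix N 1 x y := by
  cases N with
  | zero => simp [dirichletDensityMatrix]
  | succ n =>
    show (n + 1 : ℝ) * ∫ X in Set.pi Set.univ (fun _ : Fin n => Set.Icc (0 : ℝ) L),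
          dirichletState (n + 1) L (Fin.cons (L * x) X) *
            dirichletState (n + 1) L (Fin.cons (L * y) X) =
        L⁻¹ * ((n + 1 : ℝ) * ∫ X in Set.pi Set.univ (fun _ : Fin n => Set.Icc (0 : ℝ) 1),
          dirichletState (n + 1) 1 (Fin.cons x X) * dirichletState (n + 1) 1 (Fin.cons y X))
    rw [setIntegral_box_comp_smul hL]
    have hc : (Real.sqrt (L ^ (n + 1)))⁻¹ * (Real.sqrt (L ^ (n + 1)))⁻¹ = (L ^ (n + 1))⁻¹ := by
      rw [← mul_inv, Real.mul_self_sqrt (pow_nonneg hL.le _)]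
    have hpt : ∀ X : Fin n → ℝ,
        dirichletState (n + 1) L (Fin.cons (L * x) (L • X)) *
            dirichletState (n + 1) L (Fin.cons (L * y) (L • X)) =
          (L ^ (n + 1))⁻¹ *
            (dirichletState (n + 1) 1 (Fin.cons x X) * dirichletState (n + 1) 1 (Fin.cons y X)) := by
      intro X
      rw [cons_smul, cons_smul, dirichletState_smul _ hL, dirichletState_smul _ hL, ← hc]
      ring
    simp_rw [hpt, integral_const_mul]
    have hL0 : L ≠ 0 := hL.ne'
    field_simp
    ring

/-- **Scale covariance of the quadratic form**: `⟨φ, γ^D_{N,L} φ⟩ = L ⟨φ(L·), γ^D_{N,1} φ(L·)⟩`.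
[folklore] -/
theorem dirichletForm_smul (N : ℕ) (hL : 0 < L) (φ : ℝ → ℂ) :
    dirichletForm N L φ = (L : ℂ) * dirichletForm N 1 (fun t => φ (L * t)) := by
  unfold dirichletForm
  rw [setIntegral_Icc_comp_mul hL]
  have hinner : ∀ x : ℝ,
      ∫ y in Set.Icc (0 : ℝ) L,
          conj (φ (L * x)) * (dirichletDensityMatrix N L (L * x) y : ℂ) * φ y =
        L • ∫ y in Set.Icc (0 : ℝ) 1, ((L⁻¹ : ℝ) : ℂ) *
          (conj (φ (L * x)) * (dirichletDensityMatrix N 1 x y : ℂ) * φ (L * y)) := by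
    intro x
    rw [setIntegral_Icc_comp_mul hL]
    congr 1
    refine setIntegral_congr_fun measurableSet_Icc fun y _ => ?_
    rw [dirichletDensityMatrix_smul N hL, Complex.ofReal_mul]
    ring
  simp_rw [hinner, integral_const_mul, Complex.real_smul]
  have hL0 : (L : ℂ) ≠ 0 := by exact_mod_cast hL.ne'
  push_cast
  field_simp

/-- **`L`-uniform mode bound in the box.** For every `ε > 0`, for all large `N` — with a threshold
that does NOT depend on `L` — every square-integrable mode in every box `[0, L]` has
`|⟨φ, γ^D_N φ⟩| ≤ ε N ‖φ‖²`; in particular along the thermodynamic limit `L_N = N/ρ` at any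
fixed density `ρ` (the conjunct's limit). [cite: ForresterFrankelGaroni2003, §4.1] -/
theorem eventually_forall_length_norm_dirichletForm_le {ε : ℝ} (hε : 0 < ε) :
    ∀ᶠ N : ℕ in atTop, ∀ L : ℝ, 0 < L → ∀ φ : ℝ → ℂ,
      IntegrableOn (fun x => ‖φ x‖ ^ 2) (Set.Icc 0 L) →
        ‖dirichletForm N L φ‖ ≤ ε * N * modeNormSq L φ := by
  filter_upwards [eventually_norm_dirichletForm_le one_pos hε] with N hN L hL φ hφ
  have h := hN (fun t => φ (L * t)) (integrableOn_comp_mul_Icc hL hφ)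
  rw [dirichletForm_smul N hL, modeNormSq_smul hL, norm_mul, Complex.norm_real, Real.norm_eq_abs,
    abs_of_pos hL]
  calc L * ‖dirichletForm N 1 fun t => φ (L * t)‖
      ≤ L * (ε * N * modeNormSq 1 fun t => φ (L * t)) := by gcongr
    _ = ε * N * (L * modeNormSq 1 fun t => φ (L * t)) := by ring

end Scaling

end Literature.Barriers.AtomisticToContinuum.BoseGas

/-! ### The named fact and its proof -/

namespace Literature.Barriers.AtomisticToContinuum

open BoseGas

/-- **No condensation into ANY mode for impenetrable bosons between Dirichlet walls (uniform
`λ_max` form of Girardeau–Lenard in the box; typed support of evasion (iii) of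
`OneDimensionalHardCore`).** For every box length `L > 0` and every `ε > 0`, for all sufficiently
large `N`, every mode `φ : ℝ → ℂ` with `|φ|²` integrable on `[0, L]` satisfies
`|⟨φ, γ^D_N φ⟩| ≤ ε · N · ‖φ‖²`, where `γ^D_N = ρ^D_N` is the one-body density matrix of the
ground state `Ψ_N = (N!(L/2)^N)^{-1/2} |det[sin((t+1)πx_r/L)]_{r,t<N}|` of `N` impenetrable
(zero-range hard-core) bosons in `[0, L]` with Dirichlet walls
(`dirichletForm N L φ = ∫₀ᴸ∫₀ᴸ conj φ(x) ρ^D_N(x,y) φ(y)`, `modeNormSq L φ = ∫₀ᴸ|φ|²`): the largest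
eigenvalue of `γ^D_N` is `o(N)` UNIFORMLY over modes. Printed sharp law: `λ_j ∝ √N`,
`λ₀ = G⁴(3/2)√N = 1.3069√N` [cite: ForresterFrankelGaroni2003, §4.1] (Coulomb-gas level; the
pointwise bulk asymptotics of the density matrix are a theorem
[cite: DeiftItsKrasovsky2011, Thm 1.20]). PROVED below (`oneDimensionalHardCoreDirichlet_holds`).
BARRIER (D-0021), AtomisticToContinuum/BoseEinsteinCondensation:
technique_class: dimension-independent coupling-independent interaction-independent ground-state repulsive-generic hard-core-valid boundary-condition-independent
blocks: the boundary-condition escape from `OneDimensionalHardCore` / `OneDimensionalHardCoreNarrow` (which are periodic-ring statements while the conjunct lives in Dirichlet boxes): arguments for the conjunct (ground-state BEC, Dirichlet boxes, thermodynamic limit, dilute `d = 3`) every step of which remains valid for the IMPENETRABLE one-dimensional gas IN A DIRICHLET BOX in the thermodynamic limit — by scale invariance of that gas, at every density — e.g. mechanisms using of `v` only repulsivity / hard-core admissibility, of the ground state only positivity, permutation symmetry and the Dirichlet condition at the walls, of the limit only `N → ∞` in boxes, with no small coupling parameter: transported to `d = 1` they would give `λ_max(γ^D_N) ≥ cN`,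 contradicting the typed uniform bound; with the ring entries this closes "use the walls" as an evasion of the Girardeau–Lenard obstruction [cite: ForresterFrankelGaroni2003, §4.1]
because: (typed here) Girardeau's map with Dirichlet orbitals — `det[sin((t+1)θ_r)] = (∏_r sin θ_r)(∏_t 2^t)∏_{r<s}(cos θ_s − cos θ_r)` (Chebyshev `U`), so `|Ψ_N|²` is the printed `Sp(N)`-type density [cite: ForresterFrankelGaroni2003, §1] and the sign of `Φ(a, X)Φ(b, X)` is `∏_j s(x_j)` by monotonicity of `cos` on `[0, π]`; Laplace expansion and Andréief give Lenard's formula `ρ^D_N(a, b) = (2/L)⟨f(b), adj(1 − 2Q)f(a)⟩` with `Q` the arc-overlap matrix of the lowest `N` orbitals (the finite-`N` density matrix is a Jacobi-ensemble average [cite: ForresterFrankelGaroni2003, §3]); the Hermitian adjugate bound gives `ρ^D_N ≤ (2N/L)e^{1/2}e^{−2V_N}`, `V_N = tr Q − ‖Q‖²_F` the free-fermion number variance of the arc; Bessel's inequality for the sine system, the four-block lemma `∑_{j<4}(sin((y+j)β) − sin((y+j)α))² ≥ (cos β − cos α)²(sin²α + sin²β)/15` and a triangular re-summation give `V_N ≥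 κ(a,b)H_{⌊N/4⌋}/(120π²) − 4/π²`, `κ = (cos θ_a − cos θ_b)²(sin²θ_a + sin²θ_b)`; the rows of the majorant `exp(−κH_{⌊N/4⌋}/60π²)` tend to zero UNIFORMLY on `[0, L]` by Dini's theorem (continuous, non-increasing in `N`, pointwise null limit off a countable set), whence the mode bound by weighted AM–GM [folklore]
evasions_known: as the parent entries, (i)–(x) of `OneDimensionalHardCore`; in particular the Neumann-CONTACT rods of `OneDimensionalHardCoreNeumannRods` (which condense) change the boundary condition at particle contact, not at the walls — Neumann WALLS for the zero-range gas give the same printed `√N` law [cite: ForresterFrankelGaroni2003, §1 and §4.1] (not typed here)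
scope_caveats: (a) typed and proved: the uniform mode bound for the ZERO-RANGE impenetrable gas in the DIRICHLET box, every `L²[0, L]` mode (no measurability of `φ` assumed, as in `OneDimensionalHardCoreNarrow`), in the limit `N → ∞` at fixed `L` — which is the thermodynamic limit at every density by the scale invariance `Ψ_{N,L}(L·) = L^{-N/2}Ψ_{N,1}`, `⟨φ, γ^D_{N,L}φ⟩ = L⟨φ(L·), γ^D_{N,1}φ(L·)⟩` (typed at the end of this file: `dirichletState_smul`, `dirichletDensityMatrix_smul`, `dirichletForm_smul`, and the `L`-independent threshold `oneDimensionalHardCoreDirichlet_uniform`, covering `L_N = N/ρ`); also typed: the negated conjunct shape `not_exists_linear_le_dirichletForm` and the trace normalisation `∫₀ᴸρ^D_N(x, x)dx = N` (`integral_dirichletDensity_diag`, non-vacuity); (b) NOT typed: the `√N` ORDER and the constant `1.3069` [cite: ForresterFrankelGaroni2003, §4.1], Neumann walls, harmonic traps, hard rods of positive length between walls, finite Lieb–Liniger coupling; (c) the quantitative content is Schultz-type (a Gaussian bound through the number variance, losing a factor in the exponent against Fisher–Hartwig), exactly as for the ring proof (parent caveat (i)): harmless for `o(N)`, useless for the order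 `√N`; (d) the interaction-class caveats (e), (g) of the parent apply verbatim (the zero-range core is the `ρa → 0` endpoint of rods; a mechanism using the positive excluded volume essentially is not caught by this file)
status: established (proved below, `oneDimensionalHardCoreDirichlet_holds`; axioms `propext`, `Classical.choice`, `Quot.sound`)
[cite: ForresterFrankelGaroni2003, §4.1] [cite: DeiftItsKrasovsky2011, Thm 1.20] -/
def OneDimensionalHardCoreDirichlet : Prop :=
  ∀ L : ℝ, 0 < L → ∀ ε : ℝ, 0 < ε → ∀ᶠ N : ℕ in atTop, ∀ φ : ℝ → ℂ,
    IntegrableOn (fun x => ‖φ x‖ ^ 2) (Set.Icc 0 L) →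
      ‖dirichletForm N L φ‖ ≤ ε * N * modeNormSq L φ

/-- **The Dirichlet-wall barrier holds** (uniform mode bound, from
`eventually_norm_dirichletForm_le`). [cite: ForresterFrankelGaroni2003, §4.1 (printed sharp law
`λ₀ = G⁴(3/2)√N = 1.3069√N`; the `o(N)` uniform bound is proved here)] -/
theorem oneDimensionalHardCoreDirichlet_holds : OneDimensionalHardCoreDirichlet :=
  fun _ hL _ hε => eventually_norm_dirichletForm_le hL hε

/-- **`L`-uniform form of the Dirichlet-wall barrier** (thermodynamic-limit shape): the threshold
in `OneDimensionalHardCoreDirichlet` can be chosen independently of the box length `L`, so the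
uniform `λ_max` bound holds in boxes growing with `N` (`L_N = N/ρ`, the conjunct's limit).
[cite: ForresterFrankelGaroni2003, §4.1] -/
theorem oneDimensionalHardCoreDirichlet_uniform :
    ∀ ε : ℝ, 0 < ε → ∀ᶠ N : ℕ in atTop, ∀ L : ℝ, 0 < L → ∀ φ : ℝ → ℂ,
      IntegrableOn (fun x => ‖φ x‖ ^ 2) (Set.Icc 0 L) →
        ‖dirichletForm N L φ‖ ≤ ε * N * modeNormSq L φ :=
  fun _ hε => eventually_forall_length_norm_dirichletForm_le hε

/-- **The conjunct's shape, negated, for impenetrable bosons between walls**: there is no `c > 0`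
such that for all large `N` some square-integrable mode of positive norm carries occupation
`≥ c N` in the Dirichlet box ground state. [cite: ForresterFrankelGaroni2003, §4.1] -/
theorem not_exists_linear_le_dirichletForm {L : ℝ} (hL : 0 < L) :
    ¬ ∃ c : ℝ, 0 < c ∧ ∀ᶠ N : ℕ in atTop, ∃ φ : ℝ → ℂ,
      IntegrableOn (fun x => ‖φ x‖ ^ 2) (Set.Icc 0 L) ∧ 0 < modeNormSq L φ ∧
        c * N * modeNormSq L φ ≤ ‖dirichletForm N L φ‖ := by
  rintro ⟨c, hc, hN⟩
  have h := oneDimensionalHardCoreDirichlet_holds L hL (c / 2) (half_pos hc)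
  obtain ⟨N, ⟨φ, hφ, hpos, hle⟩, hb, hN1⟩ := (hN.and (h.and (eventually_ge_atTop 1))).exists
  have hb' := hb φ hφ
  have hNpos : (1 : ℝ) ≤ N := by exact_mod_cast hN1
  have : 0 < c * N * modeNormSq L φ := by positivity
  nlinarith

end Literature.Barriers.AtomisticToContinuum

end
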